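import Literature.NumberTheory.LFunctions.GranvilleSoundararajan2003
import Literature.NumberTheory.Sieve.MatomakiRadziwillLemma4
import Literature.NumberTheory.LFunctions.MertensElementary
import Mathlib.Analysis.SpecialFunctions.Pow.Complex

/-!
# Matomäki–Radziwiłł 2016, Lemma 4: the long-sum Lipschitz bound from Granville–Soundararajan

Topic `NumberTheory/Sieve`.  This file **proves** the named fact
`Literature.NumberTheory.Sieve.MatomakiRadziwill2016_lemma4_lipschitz` of `MatomakiRadziwillLemma4.lean` (eq. "Lipsch" of
Matomäki–Radziwiłł, Ann. of Math. 183 (2016), §3, proof of Lemma 4: for real multiplicative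
`f : ℕ → [-1,1]` and `X/4 ≤ Y ≤ X`, `|X⁻¹ ∑_{n≤X} f(n) - Y⁻¹ ∑_{n≤Y} f(n)| ≪ (log X)^{-1/4}`) from the
named facts of Granville–Soundararajan 2003 vendored in
`Literature/NumberTheory/LFunctions/GranvilleSoundararajan2003.lean` (Theorem 1 = sharp Halász,
Lemma 2.3, Theorem 3, Theorem 4 on `w ≤ √x`, Corollary 3 on `w ≤ √x`, Lemma 7.1):

* `MatomakiRadziwillL4A.lipschitz_of_GS :
    theorem1 → lemma23 → theorem3 → theorem4_sqrtRange → corollary3 → lemma71 → MatomakiRadziwill2016_lemma4_lipschitz`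
* `MatomakiRadziwill2016_lemma4_of_GS : … → MatomakiRadziwill2016_lemma4` (composition with the
  proved `MatomakiRadziwill2016_lemma4_of_lipschitz`).

**Both entry points are `@[deprecated]` since the 2026-08-15 verdict clean-up** (vacuous: their fourth
input `GranvilleSoundararajan2003_theorem4_sqrtRange`, GS03 Theorem 4 asserted for EVERY maximiser of the
window, is refuted in tree — `GranvilleSoundararajan2003_theorem4_sqrtRange_false`,
`GranvilleSoundararajan2003Theorem4EdgeRefutation.lean` — and itself `@[deprecated]`).  The same proof fed by
the corrected central form of Theorem 4 is `MatomakiRadziwillL4A.lipschitz_of_GS_central` /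
`lipschitz_of_GS_of_theorem4_central` and `MatomakiRadziwill2016_lemma4_of_GS_central`
(`MatomakiRadziwillLemma4LipschitzCentral.lean`), and the unconditional discharges are
`MatomakiRadziwill2016_lemma4_lipschitz_holds`, `MatomakiRadziwill2016_lemma4_holds`
(`MatomakiRadziwillTheorem3VK.lean`).  The helper lemmas of this file (namespace `MatomakiRadziwillL4A`) are
unaffected and remain in use there.

The printed proof (arXiv pp. 9–10) runs through the minimiser `t_f` of the pretentious distance and cites
"[GS03]" for the twisted comparison (eq. "Lipcons") and for `||S(X)|/X - |S(Y)|/Y|| ≪ (log X)^{-1/4}`.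
We follow it with the maximiser `y₀` of `|F_X(1+iy)|` on `|y| ≤ 2 log X` (`exists_maximiser`;
`F_X = truncEulerProduct`, the object in which GS03 is formulated) in place of `t_f`, which avoids the
comparison "`|F(1+iy)|` large ⇔ distance small" in its unsafe direction (an Euler factor at `p = 2` may
vanish on the line `Re s = 1` for a merely multiplicative `f`).  With `S(Z) = ∑_{n ≤ Z} f(n)`,
`w = X/Y ∈ [1, 4]`, `ℓ = log X`:

1. **Equal signs.** Corollary 3 gives `||S(X)|/X - |S(Y)|/Y| ≤ 96|C| ℓ^{-1/4}` (`hStep1`), which is the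
   claim when `S(X) S(Y) ≥ 0`.
2. **Opposite signs.** Then `|S(X)/X - S(Y)/Y| = |S(X)|/X + |S(Y)|/Y ≤ 2|S(X)|/X + 96|C|ℓ^{-1/4}`, and
   `|S(X)|/X ≪ ℓ^{-1/4}` in each of four cases:
   * `|y₀| ≥ ℓ/2`: Theorem 3.
   * `1/100 ≤ |y₀| < ℓ/2`: for real `f`, `F(1-iy) = conj F(1+iy)` (`truncEulerProduct_conj`), so Lemma 2.3
     at `(y, β) = (-y₀, 2y₀)` bounds `|F(1+iy₀)|² ≪ ℓ^{4/π}(50 (log ℓ)²)`, whence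
     `L = max|F|/ℓ ≪ ℓ^{-9/25} log ℓ`, and Theorem 1 (`thm1_with_bound`: `L(log(e^γ/L)+12/7) ≤ 43L^{39/40}`
     for `L ≤ 1`) gives `|S(X)|/X ≪ ℓ^{-1/4}` (the paper's "`(1 - 2/π - o(1)) log log X`" lower bound for
     the distance at `|t| ≥ 1/100`).
   * `|y₀| < 1/100`, `M(y₀) = ∑_{p≤X}(1 - Re f(p)p^{-iy₀})/p ≥ 0.27 log ℓ`: the *upper* bound
     `|F(1+iy₀)| ≤ e⁷ ℓ e^{-M(y₀)}` (`norm_truncEulerProduct_le`, from `‖1+z‖ ≤ exp(Re z + |z|²/2)`, the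
     tail `∑_{k≥2} p^{-k}` and Mertens' `∑_{p≤X} 1/p ≤ log log X + 4` of `MertensElementary.lean`) makes `L`
     small and Theorem 1 applies again.
   * `|y₀| < 1/100`, `M(y₀) < 0.27 log ℓ`: by Cauchy–Schwarz ((7.4) of GS03, `sq_sum_norm_one_sub_le`)
     `∑_{p≤X}|1 - f(p)p^{-iy₀}|/p ≤ 0.735 log ℓ + 3`, so Lemma 7.1 applied to the twist `f(n)n^{-iy₀}`
     (`twistAF`) at `Z ∈ {X, Y}` gives `S(Z)/Z = Z^{iy₀}(1+iy₀)⁻¹ b_Z + O(ℓ^{-0.265})` with the twisted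
     averages `b_Z`, Theorem 4 gives `|b_X - b_Y| ≪ ℓ^{-1/4}`, and `|X^{iy₀} - Y^{iy₀}| ≤ |y₀| log 4 ≤ 0.0142`
     (`norm_cpow_sub_cpow_le`); the abstract `sign_trick` (Matomäki–Radziwiłł's closing argument) then
     forces `|S(X)|/X ≤ 3E + η ≪ ℓ^{-1/4}`.

Exponents of GS03 (`1 - 2/π`, `2 - √3`, `4/π`, `1 + 2(1-2/π)`) are replaced by rational bounds
(`9/25 ≤ 1-2/π ≤ 1/2`, `267/1000 ≤ 2-√3`, `4/π ≤ 32/25`) via `π ∈ (3.14, 4)`, `√3 ≤ 1.733`; powers of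
`log ℓ` are absorbed by `log ℓ ≤ ℓ^ε/ε` (`log_mul_rpow_neg_le_quarter`, `log_sq_mul_rpow_neg_le_quarter`).
Constants: `C = 2B₃ + 96|C_c| + 2`, `B₃ = 333|C₃| + 43A + 43e⁷ + 6|C₁| + 123|C₇| + 368|C₄|`,
`A = 10√(50 max(C₂₃,1))`, `X₀ = exp(max(e^{27}, A⁴))`.

## References

* K. Matomäki, M. Radziwiłł, *Multiplicative functions in short intervals*, Ann. of Math. (2) 183
  (2016), §3, Lemma 4 and its proof (arXiv:1501.04585, pp. 9–10).
* A. Granville, K. Soundararajan, *Decay of mean values of multiplicative functions*, Canad. J. Math.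
  55 (2003), 1191–1230 (arXiv:math/9911246): Theorem 1, Lemma 2.3, Theorems 3–4, Corollary 3, (4.5),
  (7.4), Lemma 7.1.
-/

noncomputable section

open Finset Filter Complex
open Literature.NumberTheory.LFunctions.GranvilleSoundararajan

namespace Literature.NumberTheory.Sieve


namespace MatomakiRadziwillL4A

/-! ### Real multiplicative functions as complex ones, and the twist `f(n) n^{-iy}` -/

/-- A real arithmetic function viewed as a complex one (Mathlib's `ArithmeticFunction` has the coercions
`natCoe`, `intCoe` only). [folklore] -/
def toComplexAF (f : ArithmeticFunction ℝ) : ArithmeticFunction ℂ :=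
  ⟨fun n => (f n : ℂ), by simp⟩

/-- Values of the complexified function. [folklore] -/
@[simp] theorem toComplexAF_apply (f : ArithmeticFunction ℝ) (n : ℕ) : toComplexAF f n = (f n : ℂ) := rfl

/-- Complexification preserves multiplicativity. [folklore] -/
theorem isMultiplicative_toComplexAF {f : ArithmeticFunction ℝ} (hf : f.IsMultiplicative) :
    (toComplexAF f).IsMultiplicative := by
  refine ⟨by simp [hf.map_one], fun {m n} hmn => ?_⟩
  simp [hf.map_mul_of_coprime hmn]

/-- `‖f(n)‖ ≤ 1` is preserved. [folklore] -/
theorem norm_toComplexAF_le {f : ArithmeticFunction ℝ} (hf : ∀ n, |f n| ≤ 1) (n : ℕ) :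
    ‖toComplexAF f n‖ ≤ 1 := by
  rw [toComplexAF_apply, Complex.norm_real, Real.norm_eq_abs]; exact hf n

/-- The twist `n ↦ g(n) n^{-iy}` of a complex arithmetic function (GS03 §6: `f₀(n) = f(n) n^{-iy₀}`).
[cite: GranvilleSoundararajan2003, §6] -/
def twistAF (g : ArithmeticFunction ℂ) (y : ℝ) : ArithmeticFunction ℂ :=
  ⟨fun n => g n * (n : ℂ) ^ (-(y * I)), by simp⟩

/-- Values of the twist. [folklore] -/
@[simp] theorem twistAF_apply (g : ArithmeticFunction ℂ) (y : ℝ) (n : ℕ) :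
    twistAF g y n = g n * (n : ℂ) ^ (-(y * I)) := rfl

/-- `(mn)^s = m^s n^s` for naturals. [folklore] -/
theorem natCast_mul_cpow (m n : ℕ) (s : ℂ) : ((m * n : ℕ) : ℂ) ^ s = (m : ℂ) ^ s * (n : ℂ) ^ s := by
  rw [Nat.cast_mul, show (m : ℂ) = ((m : ℝ) : ℂ) by simp, show (n : ℂ) = ((n : ℝ) : ℂ) by simp,
    Complex.mul_cpow_ofReal_nonneg (Nat.cast_nonneg m) (Nat.cast_nonneg n)]

/-- The twist `f(n) n^{-iy}` of a multiplicative function is multiplicative. [folklore] -/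
theorem isMultiplicative_twistAF {g : ArithmeticFunction ℂ} (hg : g.IsMultiplicative) (y : ℝ) :
    (twistAF g y).IsMultiplicative := by
  refine ⟨by simp [hg.map_one], fun {m n} hmn => ?_⟩
  simp only [twistAF_apply, hg.map_mul_of_coprime hmn, natCast_mul_cpow]
  ring

/-- `‖n^{it}‖ ≤ 1`. [folklore] -/
theorem norm_natCast_cpow_mul_I (n : ℕ) (t : ℝ) : ‖(n : ℂ) ^ (t * I)‖ ≤ 1 := by
  rcases Nat.eq_zero_or_pos n with h | h
  · subst h
    rcases eq_or_ne ((t : ℂ) * I) 0 with h0 | h0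
    · rw [h0, cpow_zero, norm_one]
    · rw [Nat.cast_zero, zero_cpow h0, norm_zero]; exact zero_le_one
  · have hn : (0 : ℝ) < n := by exact_mod_cast h
    rw [show (n : ℂ) = ((n : ℝ) : ℂ) by simp, Complex.norm_cpow_eq_rpow_re_of_pos hn]
    simp

/-- `‖f(n) n^{-iy}‖ ≤ 1`. [folklore] -/
theorem norm_twistAF_le {g : ArithmeticFunction ℂ} (hg : ∀ n, ‖g n‖ ≤ 1) (y : ℝ) (n : ℕ) :
    ‖twistAF g y n‖ ≤ 1 := by
  rw [twistAF_apply, norm_mul]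
  have h := norm_natCast_cpow_mul_I n (-y)
  rw [show ((-y : ℝ) : ℂ) * I = -(y * I) by push_cast; ring] at h
  exact mul_le_one₀ (hg n) (norm_nonneg _) h

/-! ### Continuity of `y ↦ F(1+iy)` and existence of a maximiser -/

/-- Each Euler factor is continuous in `y` on the line `1 + iy` (uniformly convergent series). [folklore] -/
theorem continuous_eulerFactor {g : ℕ → ℂ} (hg : ∀ n, ‖g n‖ ≤ 1) {p : ℕ} (hp : 2 ≤ p) :
    Continuous fun y : ℝ => eulerFactor g p (1 + y * I) := by
  unfold eulerFactor
  have hp1 : (1 : ℝ) < p := by exact_mod_cast hp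
  have hp0 : (0 : ℝ) < p := by linarith
  refine continuous_tsum (fun k => ?_) (summable_geometric_of_lt_one (by positivity)
    (inv_lt_one_of_one_lt₀ hp1)) (fun k y => ?_)
  · refine continuous_const.mul ?_
    refine Continuous.const_cpow (by fun_prop) (Or.inl (by exact_mod_cast hp0.ne'))
  · have := norm_term_le hg hp (1 + y * I) k
    simp only [add_re, one_re, mul_re, ofReal_re, I_re, mul_zero, ofReal_im, I_im, mul_one,
      sub_self, add_zero, Real.rpow_neg_one] at this
    simpa [inv_pow] using this

/-- `y ↦ F(1+iy)` is continuous. [folklore] -/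
theorem continuous_truncEulerProduct {g : ℕ → ℂ} (hg : ∀ n, ‖g n‖ ≤ 1) (x : ℝ) :
    Continuous fun y : ℝ => truncEulerProduct g x (1 + y * I) := by
  unfold truncEulerProduct
  refine continuous_finsetProd _ fun p hp => ?_
  exact continuous_eulerFactor hg (Nat.prime_of_mem_primesBelow hp).two_le

/-- A maximiser `y₀` of `|F(1+iy)|` on `[-2T, 2T]` exists. [folklore] -/
theorem exists_maximiser {g : ℕ → ℂ} (hg : ∀ n, ‖g n‖ ≤ 1) (x : ℝ) {T : ℝ} (hT : 0 ≤ T) :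
    ∃ y₀ : ℝ, |y₀| ≤ 2 * T ∧ ∀ y : ℝ, |y| ≤ 2 * T →
      ‖truncEulerProduct g x (1 + y * I)‖ ≤ ‖truncEulerProduct g x (1 + y₀ * I)‖ := by
  have hc : ContinuousOn (fun y : ℝ => ‖truncEulerProduct g x (1 + y * I)‖) (Set.Icc (-(2 * T)) (2 * T)) :=
    ((continuous_truncEulerProduct hg x).norm).continuousOn
  obtain ⟨y₀, hy₀, hmax⟩ := (isCompact_Icc).exists_isMaxOn (Set.nonempty_Icc.2 (by linarith)) hc
  refine ⟨y₀, abs_le.2 ⟨by linarith [hy₀.1], hy₀.2⟩, fun y hy => hmax (abs_le.1 hy |> fun h => ⟨by linarith [h.1], h.2⟩)⟩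

/-! ### Conjugation symmetry for real `f`: `F(1 - iy) = conj F(1 + iy)` -/

/-- `p^{conj w} = conj(p^w)` for a natural base. [folklore] -/
theorem natCast_cpow_conj (p : ℕ) (w : ℂ) :
    (p : ℂ) ^ ((starRingEnd ℂ) w) = (starRingEnd ℂ) ((p : ℂ) ^ w) := by
  have harg : (p : ℂ).arg ≠ Real.pi := by
    rw [show (p : ℂ) = ((p : ℝ) : ℂ) by simp, Complex.arg_ofReal_of_nonneg (Nat.cast_nonneg p)]
    exact Real.pi_pos.ne
  rw [Complex.cpow_conj _ _ harg, show (starRingEnd ℂ) (p : ℂ) = p from Complex.conj_natCast p]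

/-- For real `f`, `F_p(conj s) = conj F_p(s)`. [folklore] -/
theorem eulerFactor_conj (f : ArithmeticFunction ℝ) (p : ℕ) (s : ℂ) :
    eulerFactor (toComplexAF f) p ((starRingEnd ℂ) s) = (starRingEnd ℂ) (eulerFactor (toComplexAF f) p s) := by
  unfold eulerFactor
  rw [Complex.conj_tsum]
  refine tsum_congr fun k => ?_
  rw [map_mul, toComplexAF_apply, Complex.conj_ofReal, ← natCast_cpow_conj]
  congr 1
  simp [map_neg, map_mul]

/-- For real `f`, `F(conj s) = conj F(s)`. [folklore] -/
theorem truncEulerProduct_conj (f : ArithmeticFunction ℝ) (x : ℝ) (s : ℂ) :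
    truncEulerProduct (toComplexAF f) x ((starRingEnd ℂ) s)
      = (starRingEnd ℂ) (truncEulerProduct (toComplexAF f) x s) := by
  unfold truncEulerProduct
  rw [map_prod]
  exact Finset.prod_congr rfl fun p _ => eulerFactor_conj f p s

/-- For real `f`, `|F(1 - iy)| = |F(1 + iy)|`. [folklore] -/
theorem norm_truncEulerProduct_neg (f : ArithmeticFunction ℝ) (x y : ℝ) :
    ‖truncEulerProduct (toComplexAF f) x (1 + ((-y : ℝ) : ℂ) * I)‖
      = ‖truncEulerProduct (toComplexAF f) x (1 + y * I)‖ := by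
  have : (1 : ℂ) + ((-y : ℝ) : ℂ) * I = (starRingEnd ℂ) (1 + y * I) := by
    simp [map_add, map_mul, Complex.conj_ofReal, Complex.conj_I]
  rw [this, truncEulerProduct_conj, Complex.norm_conj]

/-! ### The pretentious sum `M(y) = ∑_{p ≤ x} (1 - Re f(p) p^{-iy})/p` and the upper bound for `|F|` -/

/-- `M(y) = ∑_{p ≤ x} (1 - Re g(p) p^{-iy})/p` — the pretentious distance `𝔻(g, n^{iy}; x)²` of
`Literature/NumberTheory/Sieve/PretentiousDistance.lean` written with the sign convention of GS03 (1.2);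
it **is** `Literature.pretentiousDistSq g (fun n => (n : ℂ) ^ ((y : ℂ) * I)) x` (`Msum_eq_pretentiousDistSq`
below), and is kept as a thin local name only because the proofs unfold the summand in this shape.
[cite: GranvilleSoundararajan2003, (1.2)] -/
def Msum (g : ℕ → ℂ) (x y : ℝ) : ℝ :=
  ∑ p ∈ Nat.primesBelow (⌊x⌋₊ + 1), (1 - (g p * (p : ℂ) ^ (-(y * I))).re) / p

/-- `Msum` is the Literature pretentious distance: `M(y) = 𝔻(g, n^{iy}; x)²`
(`Literature.NumberTheory.Sieve.pretentiousDistSq`, with `conj (p^{iy}) = p^{-iy}` and `Nat.primesBelow (n+1) = Nat.primesLE n`).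
[folklore] -/
theorem Msum_eq_pretentiousDistSq (g : ℕ → ℂ) (x y : ℝ) :
    Msum g x y = Literature.NumberTheory.Sieve.pretentiousDistSq g (fun n => (n : ℂ) ^ ((y : ℂ) * I)) x := by
  unfold Msum Literature.NumberTheory.Sieve.pretentiousDistSq
  refine Finset.sum_congr rfl fun p _ => ?_
  congr 3
  rw [← natCast_cpow_conj]
  congr 1
  simp [map_mul, Complex.conj_ofReal, Complex.conj_I]


/-- Primes are `≥ 2`. [folklore] -/
theorem two_le_of_mem_primesBelow {N p : ℕ} (hp : p ∈ Nat.primesBelow N) : 2 ≤ p :=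
  (Nat.prime_of_mem_primesBelow hp).two_le

/-- `‖1 + z‖ ≤ exp(Re z + ‖z‖²/2)` (from `1 + u ≤ e^u`). [folklore] -/
theorem norm_one_add_le_exp (z : ℂ) : ‖1 + z‖ ≤ Real.exp (z.re + ‖z‖ ^ 2 / 2) := by
  have h1 : ‖1 + z‖ ^ 2 = 1 + 2 * z.re + ‖z‖ ^ 2 := by
    rw [Complex.sq_norm, Complex.sq_norm, Complex.normSq_apply, Complex.normSq_apply]
    simp; ring
  have h2 : ‖1 + z‖ ^ 2 ≤ Real.exp (2 * z.re + ‖z‖ ^ 2) := by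
    rw [h1]; have := Real.add_one_le_exp (2 * z.re + ‖z‖ ^ 2); linarith
  have h3 : Real.exp (2 * z.re + ‖z‖ ^ 2) = Real.exp (z.re + ‖z‖ ^ 2 / 2) ^ 2 := by
    rw [← Real.exp_nat_mul]; congr 1; ring
  rw [h3] at h2
  exact (pow_le_pow_iff_left₀ (norm_nonneg _) (Real.exp_pos _).le two_ne_zero).1 h2

/-- The Euler factor at `1 + iy` is `1 + g(p)p^{-1-iy}` up to `∑_{k ≥ 2} p^{-k} = 1/(p(p-1))`. [folklore] -/
theorem norm_eulerFactor_sub_le {g : ℕ → ℂ} (hg : ∀ n, ‖g n‖ ≤ 1) (hg1 : g 1 = 1) {p : ℕ} (hp : 2 ≤ p)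
    (y : ℝ) :
    ‖eulerFactor g p (1 + y * I) - (1 + g p * (p : ℂ) ^ (-((1 + y * I))))‖ ≤ 1 / ((p : ℝ) * ((p : ℝ) - 1)) := by
  have hp1 : (1 : ℝ) < p := by exact_mod_cast hp
  have hp0 : (0 : ℝ) < p := by linarith
  set s : ℂ := 1 + y * I with hs
  have hsre : s.re = 1 := by simp [hs]
  set F : ℕ → ℂ := fun k => g (p ^ k) * (p : ℂ) ^ (-(s * k)) with hF
  have hsum : Summable F := summable_eulerFactor hg hp (s := s) (by rw [hsre]; exact one_pos)
  have hsum1 : Summable fun k : ℕ => F (k + 1) := (summable_nat_add_iff 1).2 hsum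
  have hsum2 : Summable fun k : ℕ => F (k + 1 + 1) := (summable_nat_add_iff 1).2 hsum1
  have h0 : ∑' k, F k = F 0 + ∑' k, F (k + 1) := hsum.tsum_eq_zero_add
  have h1 : ∑' k, F (k + 1) = F (0 + 1) + ∑' k, F (k + 1 + 1) := hsum1.tsum_eq_zero_add
  have hF0 : F 0 = 1 := by simp [hF, hg1]
  have hF1 : F (0 + 1) = g p * (p : ℂ) ^ (-s) := by simp [hF]
  have e : eulerFactor g p s - (1 + g p * (p : ℂ) ^ (-s)) = ∑' k, F (k + 1 + 1) := by
    rw [show eulerFactor g p s = ∑' k, F k from rfl, h0, h1, hF0, hF1]; ring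
  rw [e]
  -- bound by the geometric tail
  set r : ℝ := (p : ℝ)⁻¹ with hr_def
  have hr : r < 1 := inv_lt_one_of_one_lt₀ hp1
  have hr0 : 0 ≤ r := by positivity
  have hterm : ∀ k : ℕ, ‖F (k + 1 + 1)‖ ≤ r ^ 2 * r ^ k := by
    intro k
    have := norm_term_le hg hp s (k + 1 + 1)
    rw [hsre, Real.rpow_neg_one] at this
    calc ‖F (k + 1 + 1)‖ ≤ (p : ℝ)⁻¹ ^ (k + 1 + 1) := this
      _ = r ^ 2 * r ^ k := by rw [hr_def]; ring
  have hgeo : HasSum (fun k : ℕ => r ^ 2 * r ^ k) (r ^ 2 * (1 - r)⁻¹) :=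
    (hasSum_geometric_of_lt_one hr0 hr).mul_left _
  calc ‖∑' k : ℕ, F (k + 1 + 1)‖ ≤ ∑' k : ℕ, ‖F (k + 1 + 1)‖ := norm_tsum_le_tsum_norm hsum2.norm
    _ ≤ ∑' k : ℕ, r ^ 2 * r ^ k := hsum2.norm.tsum_le_tsum hterm hgeo.summable
    _ = r ^ 2 * (1 - r)⁻¹ := hgeo.tsum_eq
    _ = 1 / ((p : ℝ) * ((p : ℝ) - 1)) := by
        rw [hr_def]
        field_simp


/-- The term of `M(y)`: `Re(g(p) p^{-(1+iy)}) = Re(g(p) p^{-iy})/p`. [folklore] -/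
theorem re_mul_cpow_neg_one_add {p : ℕ} (hp : 2 ≤ p) (a : ℂ) (y : ℝ) :
    (a * (p : ℂ) ^ (-((1 : ℂ) + y * I))).re = (a * (p : ℂ) ^ (-(y * I))).re / p := by
  have hp0 : (p : ℂ) ≠ 0 := by exact_mod_cast (by omega : p ≠ 0)
  have e : (p : ℂ) ^ (-((1 : ℂ) + y * I)) = (p : ℂ)⁻¹ * (p : ℂ) ^ (-(y * I)) := by
    rw [neg_add, Complex.cpow_add _ _ hp0, Complex.cpow_neg_one]
  rw [e, ← mul_assoc, mul_comm a, mul_assoc, show (p : ℂ)⁻¹ = ((p : ℝ)⁻¹ : ℝ) by simp,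
    Complex.re_ofReal_mul]
  ring

/-- `‖p^{-(1+iy)}‖ = 1/p`. [folklore] -/
theorem norm_cpow_neg_one_add {p : ℕ} (hp : 2 ≤ p) (y : ℝ) : ‖(p : ℂ) ^ (-((1 : ℂ) + y * I))‖ = (p : ℝ)⁻¹ := by
  have hp0 : (0 : ℝ) < p := by exact_mod_cast (by omega : 0 < p)
  rw [show (p : ℂ) = ((p : ℝ) : ℂ) by simp, Complex.norm_cpow_eq_rpow_re_of_pos hp0]
  simp [Real.rpow_neg_one]

/-- **One Euler factor**: `‖F_p(1+iy)‖ ≤ exp(Re(g(p)p^{-iy})/p + 3/(p(p-1)))`. [folklore] -/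
theorem norm_eulerFactor_le_exp {g : ℕ → ℂ} (hg : ∀ n, ‖g n‖ ≤ 1) (hg1 : g 1 = 1) {p : ℕ} (hp : 2 ≤ p)
    (y : ℝ) :
    ‖eulerFactor g p (1 + y * I)‖ ≤
      Real.exp ((g p * (p : ℂ) ^ (-(y * I))).re / p + 3 / ((p : ℝ) * ((p : ℝ) - 1))) := by
  have hp1 : (1 : ℝ) < p := by exact_mod_cast hp
  have hp2 : (2 : ℝ) ≤ p := by exact_mod_cast hp
  have hp0 : (0 : ℝ) < p := by linarith
  set z : ℂ := g p * (p : ℂ) ^ (-((1 : ℂ) + y * I)) with hz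
  set R : ℝ := 1 / ((p : ℝ) * ((p : ℝ) - 1)) with hR
  have hpp : 0 < (p : ℝ) * ((p : ℝ) - 1) := mul_pos hp0 (by linarith)
  have hR0 : 0 ≤ R := by rw [hR]; exact div_nonneg zero_le_one hpp.le
  have hzn : ‖z‖ ≤ (p : ℝ)⁻¹ := by
    rw [hz, norm_mul, norm_cpow_neg_one_add hp]
    exact mul_le_of_le_one_left (by positivity) (hg p)
  have hzn2 : ‖z‖ ≤ 1 / 2 := hzn.trans (by rw [inv_eq_one_div]; exact one_div_le_one_div_of_le two_pos hp2)
  have happrox : ‖eulerFactor g p (1 + y * I) - (1 + z)‖ ≤ R := norm_eulerFactor_sub_le hg hg1 hp y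
  -- `‖1 + z‖ ≥ 1/2`, `‖F_p‖ ≤ ‖1+z‖ + R ≤ ‖1+z‖ (1 + 2R) ≤ exp(Re z + ‖z‖²/2) exp(2R)`
  have h1z : 1 / 2 ≤ ‖1 + z‖ := by
    have := norm_sub_norm_le (1 : ℂ) (-z)
    rw [norm_one, norm_neg, sub_neg_eq_add] at this
    linarith
  have hA := norm_one_add_le_exp z
  have hstep : ‖eulerFactor g p (1 + y * I)‖ ≤ ‖1 + z‖ * (1 + 2 * R) := by
    have := norm_le_norm_add_norm_sub' (eulerFactor g p (1 + y * I)) (1 + z)  -- ‖a‖ ≤ ‖b‖ + ‖a - b‖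
    nlinarith [happrox, h1z, hR0]
  have hexpR : 1 + 2 * R ≤ Real.exp (2 * R) := by have := Real.add_one_le_exp (2 * R); linarith
  have hz2 : ‖z‖ ^ 2 / 2 ≤ R := by
    rw [hR]
    have h1 : ‖z‖ ^ 2 ≤ (p : ℝ)⁻¹ ^ 2 := pow_le_pow_left₀ (norm_nonneg _) hzn 2
    have h2 : (p : ℝ)⁻¹ ^ 2 / 2 ≤ 1 / ((p : ℝ) * ((p : ℝ) - 1)) := by
      rw [inv_pow, ← one_div, div_div, div_le_div_iff₀ (by positivity) hpp]
      nlinarith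
    linarith [div_le_div_of_nonneg_right h1 zero_le_two]
  have hre : z.re = (g p * (p : ℂ) ^ (-(y * I))).re / p := re_mul_cpow_neg_one_add hp (g p) y
  calc ‖eulerFactor g p (1 + y * I)‖ ≤ ‖1 + z‖ * (1 + 2 * R) := hstep
    _ ≤ Real.exp (z.re + ‖z‖ ^ 2 / 2) * Real.exp (2 * R) :=
        mul_le_mul hA hexpR (by linarith) (Real.exp_pos _).le
    _ = Real.exp (z.re + ‖z‖ ^ 2 / 2 + 2 * R) := by rw [← Real.exp_add]
    _ ≤ Real.exp ((g p * (p : ℂ) ^ (-(y * I))).re / p + 3 / ((p : ℝ) * ((p : ℝ) - 1))) := by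
        refine Real.exp_le_exp.2 ?_
        rw [hre]
        have : 2 * R + R = 3 / ((p : ℝ) * ((p : ℝ) - 1)) := by rw [hR]; ring
        linarith

/-- **Upper bound for the truncated Euler product in terms of the pretentious sum** ((4.5) of GS03 in
the safe direction): `‖F(1+iy)‖ ≤ e⁷ (log x) e^{-M(y)}` for `x ≥ 2`. [folklore] -/
theorem norm_truncEulerProduct_le {g : ℕ → ℂ} (hg : ∀ n, ‖g n‖ ≤ 1) (hg1 : g 1 = 1) {x : ℝ} (hx : 2 ≤ x)
    (y : ℝ) :
    ‖truncEulerProduct g x (1 + y * I)‖ ≤ Real.exp 7 * Real.log x * Real.exp (-Msum g x y) := by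
  have hN : 2 ≤ ⌊x⌋₊ := Nat.le_floor (by simpa using hx)
  have hx1 : 1 < x := by linarith
  set P := Nat.primesBelow (⌊x⌋₊ + 1) with hP
  have hPeq : P = Nat.primesLE ⌊x⌋₊ := rfl
  have hmem : ∀ p ∈ P, 2 ≤ p := fun p hp => two_le_of_mem_primesBelow hp
  -- product of the factor bounds
  have h1 : ‖truncEulerProduct g x (1 + y * I)‖
      ≤ ∏ p ∈ P, Real.exp ((g p * (p : ℂ) ^ (-(y * I))).re / p + 3 / ((p : ℝ) * ((p : ℝ) - 1))) := by
    rw [truncEulerProduct, ← hP, norm_prod]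
    exact Finset.prod_le_prod (fun p _ => norm_nonneg _) fun p hp => norm_eulerFactor_le_exp hg hg1 (hmem p hp) y
  rw [← Real.exp_sum, Finset.sum_add_distrib] at h1
  -- the two sums
  have hM : ∑ p ∈ P, (g p * (p : ℂ) ^ (-(y * I))).re / p = (∑ p ∈ P, (1 : ℝ) / p) - Msum g x y := by
    rw [Msum, ← hP, ← Finset.sum_sub_distrib]
    refine Finset.sum_congr rfl fun p hp => ?_
    have : (p : ℝ) ≠ 0 := by have := hmem p hp; positivity
    field_simp
    ring
  have hmert : ∑ p ∈ P, (1 : ℝ) / p ≤ Real.log (Real.log x) + 4 := by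
    rw [hPeq]
    refine (Literature.NumberTheory.LFunctions.MertensBound.sum_inv_prime_le ⌊x⌋₊ hN).trans ?_
    have hfl : (⌊x⌋₊ : ℝ) ≤ x := Nat.floor_le (by linarith)
    have hfl2 : (2 : ℝ) ≤ ⌊x⌋₊ := by exact_mod_cast hN
    have := Real.log_le_log (Real.log_pos (by linarith)) (Real.log_le_log (by linarith) hfl)
    linarith
  have htail : ∑ p ∈ P, 3 / ((p : ℝ) * ((p : ℝ) - 1)) ≤ 3 := by
    have := Literature.NumberTheory.LFunctions.MertensBound.sum_inv_prime_mul_pred_le_one ⌊x⌋₊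
    rw [← hPeq] at this
    calc ∑ p ∈ P, 3 / ((p : ℝ) * ((p : ℝ) - 1)) = 3 * ∑ p ∈ P, 1 / ((p : ℝ) * ((p : ℝ) - 1)) := by
          rw [Finset.mul_sum]; exact Finset.sum_congr rfl fun p _ => by ring
      _ ≤ 3 * 1 := by gcongr
      _ = 3 := mul_one _
  refine h1.trans ?_
  rw [hM, show Real.exp 7 * Real.log x * Real.exp (-Msum g x y)
    = Real.exp (Real.log (Real.log x) + 4 - Msum g x y + 3) by
      rw [show Real.log (Real.log x) + 4 - Msum g x y + 3 = 7 + Real.log (Real.log x) + -Msum g x y by ring,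
        Real.exp_add, Real.exp_add, Real.exp_log (Real.log_pos hx1)]]
  exact Real.exp_le_exp.2 (by linarith)


/-! ### Cauchy–Schwarz: `∑ |1 - g(p)p^{-iy}|/p` in terms of `M(y)` ((7.4) of GS03) -/

/-- `‖1 - w‖² ≤ 2 (1 - Re w)` for `‖w‖ ≤ 1`. [folklore] -/
theorem norm_one_sub_sq_le {w : ℂ} (hw : ‖w‖ ≤ 1) : ‖1 - w‖ ^ 2 ≤ 2 * (1 - w.re) := by
  have h1 : ‖1 - w‖ ^ 2 = 1 - 2 * w.re + ‖w‖ ^ 2 := by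
    rw [Complex.sq_norm, Complex.sq_norm, Complex.normSq_apply, Complex.normSq_apply]
    simp; ring
  have h2 : ‖w‖ ^ 2 ≤ 1 := by nlinarith [norm_nonneg w]
  linarith

/-- **(7.4)**: `(∑_{p ≤ x} |1 - g(p)p^{-iy}|/p)² ≤ 2 (∑_{p ≤ x} 1/p) M(y)`. [cite: GranvilleSoundararajan2003, (7.4)] -/
theorem sq_sum_norm_one_sub_le {g : ℕ → ℂ} (hg : ∀ n, ‖g n‖ ≤ 1) (x y : ℝ) :
    (∑ p ∈ Nat.primesBelow (⌊x⌋₊ + 1), ‖1 - g p * (p : ℂ) ^ (-(y * I))‖ / p) ^ 2 ≤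
      2 * (∑ p ∈ Nat.primesBelow (⌊x⌋₊ + 1), (1 : ℝ) / p) * Msum g x y := by
  set P := Nat.primesBelow (⌊x⌋₊ + 1)
  have hw : ∀ p ∈ P, ‖g p * (p : ℂ) ^ (-(y * I))‖ ≤ 1 := by
    intro p _
    rw [norm_mul]
    have h := norm_natCast_cpow_mul_I p (-y)
    rw [show ((-y : ℝ) : ℂ) * I = -(y * I) by push_cast; ring] at h
    exact mul_le_one₀ (hg p) (norm_nonneg _) h
  -- Cauchy–Schwarz with `a_p = 1/√p`, `b_p = ‖1 - w_p‖/√p`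
  have hcs := Finset.sum_mul_sq_le_sq_mul_sq P (fun p => Real.sqrt (1 / p))
    (fun p => ‖1 - g p * (p : ℂ) ^ (-(y * I))‖ / Real.sqrt p)
  have e1 : ∀ p ∈ P, Real.sqrt (1 / p) * (‖1 - g p * (p : ℂ) ^ (-(y * I))‖ / Real.sqrt p)
      = ‖1 - g p * (p : ℂ) ^ (-(y * I))‖ / p := by
    intro p hp
    have hp0 : (0 : ℝ) < p := by exact_mod_cast (zero_lt_two.trans_le (two_le_of_mem_primesBelow hp))
    rw [Real.sqrt_div' _ hp0.le, Real.sqrt_one]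
    field_simp
    rw [Real.sq_sqrt hp0.le]
    ring
  have e2 : ∀ p ∈ P, Real.sqrt (1 / (p : ℝ)) ^ 2 = 1 / p := by
    intro p hp
    exact Real.sq_sqrt (by positivity)
  have e3 : ∀ p ∈ P, (‖1 - g p * (p : ℂ) ^ (-(y * I))‖ / Real.sqrt p) ^ 2 ≤ 2 * ((1 - (g p * (p : ℂ) ^ (-(y * I))).re) / p) := by
    intro p hp
    have hp0 : (0 : ℝ) < p := by exact_mod_cast (zero_lt_two.trans_le (two_le_of_mem_primesBelow hp))
    rw [div_pow, Real.sq_sqrt hp0.le, div_le_iff₀ hp0]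
    have := norm_one_sub_sq_le (hw p hp)
    calc ‖1 - g p * (p : ℂ) ^ (-(y * I))‖ ^ 2 ≤ 2 * (1 - (g p * (p : ℂ) ^ (-(y * I))).re) := this
      _ = 2 * ((1 - (g p * (p : ℂ) ^ (-(y * I))).re) / p) * p := by field_simp
  rw [Finset.sum_congr rfl e1, Finset.sum_congr rfl e2] at hcs
  refine hcs.trans ?_
  have h0 : 0 ≤ ∑ p ∈ P, (1 : ℝ) / p := Finset.sum_nonneg fun p _ => by positivity
  have h1 : ∑ p ∈ P, (‖1 - g p * (p : ℂ) ^ (-(y * I))‖ / Real.sqrt p) ^ 2 ≤ 2 * Msum g x y := by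
    rw [Msum, Finset.mul_sum]
    exact Finset.sum_le_sum e3
  calc (∑ p ∈ P, (1 : ℝ) / p) * ∑ p ∈ P, (‖1 - g p * (p : ℂ) ^ (-(y * I))‖ / Real.sqrt p) ^ 2
      ≤ (∑ p ∈ P, (1 : ℝ) / p) * (2 * Msum g x y) := mul_le_mul_of_nonneg_left h1 h0
    _ = _ := by ring


/-! ### Elementary absorption inequalities: powers of `log ℓ` against powers of `ℓ` -/

/-- `log ℓ ≤ ℓ^ε/ε` (Mathlib), packaged: `log ℓ · ℓ^{-a} ≤ ε⁻¹ ℓ^{-(a-ε)}`. [folklore] -/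
theorem log_mul_rpow_neg_le {ℓ a ε : ℝ} (hℓ : 1 ≤ ℓ) (hε : 0 < ε) :
    Real.log ℓ * ℓ ^ (-a) ≤ ε⁻¹ * ℓ ^ (-(a - ε)) := by
  have hℓ0 : 0 < ℓ := by linarith
  have h := Real.log_le_rpow_div hℓ0.le hε
  calc Real.log ℓ * ℓ ^ (-a) ≤ (ℓ ^ ε / ε) * ℓ ^ (-a) :=
        mul_le_mul_of_nonneg_right h (Real.rpow_nonneg hℓ0.le _)
    _ = ε⁻¹ * (ℓ ^ ε * ℓ ^ (-a)) := by ring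
    _ = ε⁻¹ * ℓ ^ (-(a - ε)) := by rw [← Real.rpow_add hℓ0]; ring_nf

/-- `ℓ^{-a} ≤ ℓ^{-b}` for `b ≤ a`, `ℓ ≥ 1`. [folklore] -/
theorem rpow_neg_le_rpow_neg {ℓ a b : ℝ} (hℓ : 1 ≤ ℓ) (hab : b ≤ a) : ℓ ^ (-a) ≤ ℓ ^ (-b) :=
  Real.rpow_le_rpow_of_exponent_le hℓ (by linarith)

/-- `log ℓ · ℓ^{-a} ≤ K ℓ^{-1/4}` whenever `a ≥ 1/4 + ε`: here with the data `(ε, K) = (ε, ε⁻¹)`. [folklore] -/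
theorem log_mul_rpow_neg_le_quarter {ℓ a ε : ℝ} (hℓ : 1 ≤ ℓ) (hε : 0 < ε) (ha : 1 / 4 + ε ≤ a) :
    Real.log ℓ * ℓ ^ (-a) ≤ ε⁻¹ * ℓ ^ (-(1 / 4 : ℝ)) :=
  (log_mul_rpow_neg_le hℓ hε).trans
    (mul_le_mul_of_nonneg_left (rpow_neg_le_rpow_neg hℓ (by linarith)) (by positivity))

/-- `(log ℓ)² · ℓ^{-a} ≤ ε⁻² ℓ^{-1/4}` whenever `a ≥ 1/4 + 2ε`. [folklore] -/
theorem log_sq_mul_rpow_neg_le_quarter {ℓ a ε : ℝ} (hℓ : 1 ≤ ℓ) (hε : 0 < ε) (ha : 1 / 4 + 2 * ε ≤ a) :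
    Real.log ℓ ^ 2 * ℓ ^ (-a) ≤ ε⁻¹ ^ 2 * ℓ ^ (-(1 / 4 : ℝ)) := by
  have hℓ0 : 0 < ℓ := by linarith
  have hlog0 : 0 ≤ Real.log ℓ := Real.log_nonneg hℓ
  have h := Real.log_le_rpow_div hℓ0.le hε
  have h2 : Real.log ℓ ^ 2 ≤ (ℓ ^ ε / ε) ^ 2 := pow_le_pow_left₀ hlog0 h 2
  calc Real.log ℓ ^ 2 * ℓ ^ (-a) ≤ (ℓ ^ ε / ε) ^ 2 * ℓ ^ (-a) :=
        mul_le_mul_of_nonneg_right h2 (Real.rpow_nonneg hℓ0.le _)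
    _ = ε⁻¹ ^ 2 * (ℓ ^ ε * ℓ ^ ε * ℓ ^ (-a)) := by ring
    _ = ε⁻¹ ^ 2 * ℓ ^ (-(a - 2 * ε)) := by
        rw [← Real.rpow_add hℓ0, ← Real.rpow_add hℓ0]; ring_nf
    _ ≤ ε⁻¹ ^ 2 * ℓ ^ (-(1 / 4 : ℝ)) :=
        mul_le_mul_of_nonneg_left (rpow_neg_le_rpow_neg hℓ (by linarith)) (by positivity)

/-- `u log(1/u) ≤ ε⁻¹ u^{1-ε}` for `u > 0`. [folklore] -/
theorem mul_log_inv_le {u ε : ℝ} (hu : 0 < u) (hε : 0 < ε) :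
    u * Real.log (1 / u) ≤ ε⁻¹ * u ^ (1 - ε) := by
  have h := Real.log_le_rpow_div (x := 1 / u) (by positivity) hε
  rw [one_div, Real.inv_rpow hu.le, ← Real.rpow_neg hu.le] at h
  calc u * Real.log (1 / u) = u * Real.log u⁻¹ := by rw [one_div]
    _ ≤ u * (u ^ (-ε) / ε) := mul_le_mul_of_nonneg_left h hu.le
    _ = ε⁻¹ * (u ^ (1 : ℝ) * u ^ (-ε)) := by rw [Real.rpow_one]; ring
    _ = ε⁻¹ * u ^ (1 - ε) := by rw [← Real.rpow_add hu]; ring_nf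

/-- The main term of GS03 Theorem 1 for small `L`: for `0 ≤ L ≤ 1`,
`L (log(e^γ/L) + 12/7) ≤ 43 L^{39/40}` (`γ < 1`, `L ≤ L^{39/40}`, `L log(1/L) ≤ 40 L^{39/40}`). [folklore] -/
theorem thm1_main_le {L : ℝ} (hL0 : 0 ≤ L) (hL1 : L ≤ 1) :
    L * (Real.log (Real.exp Real.eulerMascheroniConstant / L) + 12 / 7) ≤ 43 * L ^ (39 / 40 : ℝ) := by
  rcases hL0.eq_or_lt with h | hLpos
  · rw [← h]; simp [Real.zero_rpow (by norm_num : (39 / 40 : ℝ) ≠ 0)]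
  have hγ : Real.eulerMascheroniConstant < 1 := by
    have := Real.eulerMascheroniConstant_lt_two_thirds; linarith
  have hγ0 : 0 < Real.eulerMascheroniConstant := by
    have := Real.one_half_lt_eulerMascheroniConstant; linarith
  rw [Real.log_div (Real.exp_pos _).ne' hLpos.ne', Real.log_exp]
  have h1 : L * Real.log (1 / L) ≤ (1 / 40 : ℝ)⁻¹ * L ^ (1 - 1 / 40 : ℝ) :=
    mul_log_inv_le hLpos (by norm_num)
  rw [one_div, Real.log_inv] at h1
  have h2 : L ≤ L ^ (39 / 40 : ℝ) := by
    have := Real.rpow_le_rpow_of_exponent_ge hLpos hL1 (by norm_num : (39 / 40 : ℝ) ≤ 1)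
    rwa [Real.rpow_one] at this
  have h3 : (1 - 1 / 40 : ℝ) = 39 / 40 := by norm_num
  rw [h3] at h1
  nlinarith [Real.rpow_nonneg hL0 (39 / 40 : ℝ)]


/-! ### Bridging identities -/

/-- The complexified sum is the real sum. [folklore] -/
theorem sum_toComplexAF (f : ArithmeticFunction ℝ) (N : ℕ) :
    ∑ n ∈ Icc 1 N, toComplexAF f n = ((∑ n ∈ Icc 1 N, f n : ℝ) : ℂ) := by
  push_cast; rfl

/-- `‖∑ f(n)‖ = |∑ f(n)|` for real `f`. [folklore] -/
theorem norm_sum_toComplexAF (f : ArithmeticFunction ℝ) (N : ℕ) :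
    ‖∑ n ∈ Icc 1 N, toComplexAF f n‖ = |∑ n ∈ Icc 1 N, f n| := by
  rw [sum_toComplexAF, Complex.norm_real, Real.norm_eq_abs]

/-- `n^w ≠ 0` for `n ≥ 1`. [folklore] -/
theorem natCast_cpow_ne_zero {n : ℕ} (hn : 1 ≤ n) (w : ℂ) : (n : ℂ) ^ w ≠ 0 := by
  have hn0 : (n : ℂ) ≠ 0 := by exact_mod_cast (by omega : n ≠ 0)
  rw [Complex.cpow_def_of_ne_zero hn0]; exact Complex.exp_ne_zero _

/-- Untwisting the twist: `∑_{n ≤ N} (g(n) n^{-iy}) n^{iy} = ∑_{n ≤ N} g(n)`. [folklore] -/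
theorem sum_twistAF_mul_cpow (g : ArithmeticFunction ℂ) (y : ℝ) (N : ℕ) :
    ∑ n ∈ Icc 1 N, twistAF g y n * (n : ℂ) ^ ((y : ℂ) * I) = ∑ n ∈ Icc 1 N, g n := by
  refine Finset.sum_congr rfl fun n hn => ?_
  have hn1 : 1 ≤ n := (Finset.mem_Icc.1 hn).1
  rw [twistAF_apply, mul_assoc, Complex.cpow_neg, inv_mul_cancel₀ (natCast_cpow_ne_zero hn1 _), mul_one]

/-- `‖X^{iy}‖ = 1` for `X > 0`. [folklore] -/
theorem norm_ofReal_cpow_mul_I {X : ℝ} (hX : 0 < X) (y : ℝ) : ‖(X : ℂ) ^ ((y : ℂ) * I)‖ = 1 := by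
  rw [Complex.norm_cpow_eq_rpow_re_of_pos hX]; simp

/-- `‖X^{iy} - Y^{iy}‖ ≤ |y| log(X/Y)` for `0 < Y ≤ X`. [folklore] -/
theorem norm_cpow_sub_cpow_le {X Y : ℝ} (hY : 0 < Y) (hYX : Y ≤ X) (y : ℝ) :
    ‖(X : ℂ) ^ ((y : ℂ) * I) - (Y : ℂ) ^ ((y : ℂ) * I)‖ ≤ |y| * Real.log (X / Y) := by
  have hX : 0 < X := hY.trans_le hYX
  have hX0 : (X : ℂ) ≠ 0 := by exact_mod_cast hX.ne'
  have hY0 : (Y : ℂ) ≠ 0 := by exact_mod_cast hY.ne'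
  have e : (X : ℂ) ^ ((y : ℂ) * I) = (Y : ℂ) ^ ((y : ℂ) * I) * Complex.exp (I * ↑(y * Real.log (X / Y))) := by
    rw [Complex.cpow_def_of_ne_zero hX0, Complex.cpow_def_of_ne_zero hY0, ← Complex.exp_add,
      show (X : ℂ) = ((X : ℝ) : ℂ) from rfl, ← Complex.ofReal_log hX.le, ← Complex.ofReal_log hY.le,
      Real.log_div hX.ne' hY.ne']
    push_cast; ring_nf
  rw [e, ← mul_sub_one, norm_mul, norm_ofReal_cpow_mul_I hY, one_mul]
  refine (Real.norm_exp_I_mul_ofReal_sub_one_le (x := y * Real.log (X / Y))).trans (le_of_eq ?_)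
  rw [Real.norm_eq_abs, abs_mul, abs_of_nonneg (Real.log_nonneg ((one_le_div hY).2 hYX))]

/-- `1 ≤ ‖1 + iy‖`. [folklore] -/
theorem one_le_norm_one_add_mul_I (y : ℝ) : 1 ≤ ‖(1 : ℂ) + y * I‖ := by
  have h : ‖(1 : ℂ) + y * I‖ ^ 2 = 1 + y ^ 2 := by
    rw [Complex.sq_norm, Complex.normSq_apply]; simp; ring
  nlinarith [norm_nonneg ((1 : ℂ) + y * I), sq_nonneg y]

/-- `‖1 + iy‖ ≤ 1 + |y|`. [folklore] -/
theorem norm_one_add_mul_I_le (y : ℝ) : ‖(1 : ℂ) + y * I‖ ≤ 1 + |y| := by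
  calc ‖(1 : ℂ) + y * I‖ ≤ ‖(1 : ℂ)‖ + ‖(y : ℂ) * I‖ := norm_add_le _ _
    _ = 1 + |y| := by rw [norm_one, norm_mul, Complex.norm_I, mul_one, Complex.norm_real, Real.norm_eq_abs]


/-! ### The sign argument of Matomäki–Radziwiłł (abstract form) -/

/-- **The sign trick.**  If the twisted averages `b_X, b_Y` are close (`‖b_X - b_Y‖ ≤ η`, GS03 Thm 4),
each plain average `s_Z` is `P_Z u⁻¹ b_Z` up to `E` (GS03 Lemma 7.1; `P_Z = Z^{iy₀}`, `u = 1 + iy₀`,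
`‖u‖ ≤ 1.01`, `‖u⁻¹‖ ≤ 1`), the phases are close (`‖P_X - P_Y‖ ≤ 0.0142`), and `s_X, s_Y` have opposite
signs, then `|s_X| ≤ 3E + η`. [cite: MatomakiRadziwillAnnals2016, §3, proof of Lemma 4 (last paragraph)] -/
theorem sign_trick {sX sY E η : ℝ} {bX bY PX PY u : ℂ} (hu : ‖u‖ ≤ 101 / 100) (hu1 : 1 ≤ ‖u‖)
    (hPX : ‖PX‖ = 1) (hPY : ‖PY‖ = 1) (hP : ‖PX - PY‖ ≤ 142 / 10000) (hE : 0 ≤ E)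
    (hX : ‖(sX : ℂ) - PX * u⁻¹ * bX‖ ≤ E) (hY : ‖(sY : ℂ) - PY * u⁻¹ * bY‖ ≤ E)
    (hb : ‖bX - bY‖ ≤ η) (hsign : sX * sY < 0) : |sX| ≤ 3 * E + η := by
  have hPY0 : PY ≠ 0 := by intro h; rw [h, norm_zero] at hPY; exact zero_ne_one hPY
  have hu0 : u ≠ 0 := by intro h; rw [h, norm_zero] at hu1; exact absurd hu1 (by norm_num)
  have hu' : ‖u⁻¹‖ ≤ 1 := by rw [norm_inv]; exact inv_le_one_of_one_le₀ hu1
  have hbY : ‖bY‖ ≤ ‖u‖ * (|sY| + E) := by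
    have e : bY = u * PY⁻¹ * (PY * u⁻¹ * bY) := by field_simp
    have h1 : ‖PY * u⁻¹ * bY‖ ≤ |sY| + E := by
      have := norm_sub_norm_le (PY * u⁻¹ * bY) (sY : ℂ)
      rw [← norm_neg ((PY * u⁻¹ * bY) - sY), neg_sub, Complex.norm_real, Real.norm_eq_abs] at this
      linarith
    calc ‖bY‖ = ‖u * PY⁻¹ * (PY * u⁻¹ * bY)‖ := by rw [← e]
      _ = ‖u‖ * ‖PY * u⁻¹ * bY‖ := by rw [norm_mul, norm_mul, norm_inv, hPY, inv_one, mul_one]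
      _ ≤ ‖u‖ * (|sY| + E) := mul_le_mul_of_nonneg_left h1 (norm_nonneg _)
  -- the decomposition of `sX - sY`
  have e : ((sX - sY : ℝ) : ℂ) = ((sX : ℂ) - PX * u⁻¹ * bX) - ((sY : ℂ) - PY * u⁻¹ * bY)
      + u⁻¹ * (PX * (bX - bY) + (PX - PY) * bY) := by push_cast; ring
  have hdiff : |sX - sY| ≤ 2 * E + η + 142 / 10000 * (101 / 100) * (|sY| + E) := by
    rw [← Real.norm_eq_abs, ← Complex.norm_real, e]
    refine (norm_add_le _ _).trans ?_
    refine (add_le_add (norm_sub_le _ _) le_rfl).trans ?_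
    rw [norm_mul]
    have h3 : ‖PX * (bX - bY) + (PX - PY) * bY‖ ≤ η + 142 / 10000 * (101 / 100 * (|sY| + E)) := by
      refine (norm_add_le _ _).trans ?_
      rw [norm_mul, norm_mul, hPX, one_mul]
      refine add_le_add hb ?_
      exact mul_le_mul hP (hbY.trans (mul_le_mul_of_nonneg_right hu (by positivity))) (norm_nonneg _) (by norm_num)
    have h4 : ‖u⁻¹‖ * ‖PX * (bX - bY) + (PX - PY) * bY‖ ≤ 1 * (η + 142 / 10000 * (101 / 100 * (|sY| + E))) :=
      mul_le_mul hu' h3 (norm_nonneg _) zero_le_one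
    linarith
  -- opposite signs: `|sX - sY| = |sX| + |sY|`
  have hsum : |sX - sY| = |sX| + |sY| := by
    rcases lt_or_gt_of_ne (show sX ≠ 0 from fun h => by rw [h, zero_mul] at hsign; exact lt_irrefl _ hsign) with h | h
    · have hY' : 0 < sY := by nlinarith
      rw [abs_of_neg (by linarith : sX - sY < 0), abs_of_neg h, abs_of_pos hY']; ring
    · have hY' : sY < 0 := by nlinarith
      rw [abs_of_pos (by linarith : 0 < sX - sY), abs_of_pos h, abs_of_neg hY']; ring
  rw [hsum] at hdiff
  nlinarith [abs_nonneg sY, abs_nonneg sX]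

/-- **GS03 Theorem 1 with a small bound for `L`**: if `|S|/X ≤ L(log(e^γ/L) + 12/7) + R` and
`0 ≤ L ≤ L_b ≤ 1` then `|S|/X ≤ 43 L_b^{39/40} + R`. [folklore] -/
theorem thm1_with_bound {A L Lb R : ℝ} (hA : A ≤ L * (Real.log (Real.exp Real.eulerMascheroniConstant / L) + 12 / 7) + R)
    (hL0 : 0 ≤ L) (hLb : L ≤ Lb) (hLb1 : Lb ≤ 1) : A ≤ 43 * Lb ^ (39 / 40 : ℝ) + R := by
  have h1 := thm1_main_le hL0 (hLb.trans hLb1)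
  have h2 : L ^ (39 / 40 : ℝ) ≤ Lb ^ (39 / 40 : ℝ) := Real.rpow_le_rpow hL0 hLb (by norm_num)
  linarith


/-! ### Assembly: the long-sum Lipschitz bound from the GS03 facts -/

/-- Primes `≤ Z` are among the primes `≤ X` for `Z ≤ X`. [folklore] -/
theorem primesBelow_mono {Z X : ℝ} (hZX : Z ≤ X) :
    Nat.primesBelow (⌊Z⌋₊ + 1) ⊆ Nat.primesBelow (⌊X⌋₊ + 1) := by
  intro p hp
  rw [Nat.primesBelow, Finset.mem_filter, Finset.mem_range] at hp ⊢
  exact ⟨lt_of_lt_of_le hp.1 (Nat.succ_le_succ (Nat.floor_mono hZX)), hp.2⟩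

/-- `0 ≤ maxModulus ≤ ‖F(1+iy₀)‖` for a maximiser `y₀`. [folklore] -/
theorem maxModulus_le {g : ℕ → ℂ} (x : ℝ) {T y₀ : ℝ} (hT : 0 ≤ T)
    (hmax : ∀ y : ℝ, |y| ≤ 2 * T → ‖truncEulerProduct g x (1 + y * I)‖ ≤ ‖truncEulerProduct g x (1 + y₀ * I)‖) :
    0 ≤ maxModulus g x T ∧ maxModulus g x T ≤ ‖truncEulerProduct g x (1 + y₀ * I)‖ := by
  unfold maxModulus
  set S := (fun y : ℝ => ‖truncEulerProduct g x (1 + y * I)‖) '' Set.Icc (-(2 * T)) (2 * T)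
  have hne : S.Nonempty := ⟨_, ⟨0, ⟨by linarith, by linarith⟩, rfl⟩⟩
  have hbdd : BddAbove S := ⟨‖truncEulerProduct g x (1 + y₀ * I)‖, by
    rintro _ ⟨y, hy, rfl⟩; exact hmax y (abs_le.2 ⟨by linarith [hy.1], hy.2⟩)⟩
  refine ⟨?_, csSup_le hne ?_⟩
  · have h0 : ‖truncEulerProduct g x (1 + (0 : ℝ) * I)‖ ∈ S := ⟨0, ⟨by linarith, by linarith⟩, rfl⟩
    exact le_csSup_of_le hbdd h0 (norm_nonneg _)
  · rintro _ ⟨y, hy, rfl⟩; exact hmax y (abs_le.2 ⟨by linarith [hy.1], hy.2⟩)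

set_option maxHeartbeats 1600000 in
/-- **Deprecated — vacuous** (verdict clean-up 2026-08-15): the hypothesis `h4`,
`GranvilleSoundararajan2003_theorem4_sqrtRange`, is refuted in tree
(`GranvilleSoundararajan2003_theorem4_sqrtRange_false`) and `@[deprecated]`; use
`lipschitz_of_GS_central` / `lipschitz_of_GS_of_theorem4_central` (`MatomakiRadziwillLemma4LipschitzCentral.lean`,
the same proof with Theorem 4 for central maximisers) or the unconditional
`MatomakiRadziwill2016_lemma4_lipschitz_holds` (`MatomakiRadziwillTheorem3VK.lean`).
Formerly: **the long-sum Lipschitz bound (eq. Lipsch of Matomäki–Radziwiłł) from Granville–Soundararajan.**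
[cite: MatomakiRadziwillAnnals2016, §3, proof of Lemma 4] -/
@[deprecated "vacuous: the hypothesis GranvilleSoundararajan2003_theorem4_sqrtRange is refuted \
  (GranvilleSoundararajan2003_theorem4_sqrtRange_false); use \
  Literature.NumberTheory.Sieve.MatomakiRadziwillL4A.lipschitz_of_GS_central \
  (MatomakiRadziwillLemma4LipschitzCentral.lean) or MatomakiRadziwill2016_lemma4_lipschitz_holds \
  (MatomakiRadziwillTheorem3VK.lean)" (since := "2026-08-15")]
theorem lipschitz_of_GS (h1 : GranvilleSoundararajan2003_theorem1) (h23 : GranvilleSoundararajan2003_lemma23)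
    (h3 : GranvilleSoundararajan2003_theorem3) (h4 : GranvilleSoundararajan2003_theorem4_sqrtRange)
    (hc3 : GranvilleSoundararajan2003_corollary3) (h71 : GranvilleSoundararajan2003_lemma71) :
    MatomakiRadziwill2016_lemma4_lipschitz := by
  obtain ⟨C₁, H1⟩ := h1
  obtain ⟨C₂₃, H23⟩ := h23
  obtain ⟨C₃, H3⟩ := h3
  obtain ⟨C₄, x₄, H4⟩ := h4
  obtain ⟨Cc, xc, Hc⟩ := hc3
  obtain ⟨C₇, H7⟩ := h71
  -- constants and thresholds
  set C₂₃' := max C₂₃ 1 with hC₂₃'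
  have hC₂₃'1 : 1 ≤ C₂₃' := le_max_right _ _
  have hC₂₃'le : C₂₃ ≤ C₂₃' := le_max_left _ _
  set A := 10 * Real.sqrt (50 * C₂₃') with hA
  have hA1 : 1 ≤ A := by
    have : 1 ≤ Real.sqrt (50 * C₂₃') := by
      rw [show (1:ℝ) = Real.sqrt 1 by simp]; exact Real.sqrt_le_sqrt (by linarith)
    rw [hA]; linarith
  set ℓ₁ := max (Real.exp 27) (A ^ 4) with hℓ₁
  set B₃ := 333 * |C₃| + 43 * A + 43 * Real.exp 7 + 6 * |C₁| + 123 * |C₇| + 368 * |C₄| with hB₃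
  have hB₃0 : 0 ≤ B₃ := by rw [hB₃]; positivity
  refine ⟨2 * B₃ + 96 * |Cc| + 2, max (Real.exp ℓ₁) (max x₄ xc), ?_⟩
  intro f hf hf1 X Y hX0 hYX hYX'
  have hX : Real.exp ℓ₁ ≤ X := (le_max_left _ _).trans hX0
  have hx₄ : x₄ ≤ X := ((le_max_left _ _).trans (le_max_right _ _)).trans hX0
  have hxc : xc ≤ X := ((le_max_right _ _).trans (le_max_right _ _)).trans hX0
  /- sizes -/
  have hℓ₁27 : Real.exp 27 ≤ ℓ₁ := le_max_left _ _
  have hℓ₁A : A ^ 4 ≤ ℓ₁ := le_max_right _ _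
  have hXpos : 0 < X := (Real.exp_pos _).trans_le hX
  set ℓ := Real.log X with hℓ
  have hℓge : ℓ₁ ≤ ℓ := by
    rw [hℓ, ← Real.log_exp ℓ₁]; exact Real.log_le_log (Real.exp_pos _) hX
  have hℓ27 : 27 ≤ ℓ := by
    have := Real.add_one_le_exp (27 : ℝ); linarith
  have hℓ1 : 1 ≤ ℓ := by linarith
  have hℓ0 : 0 < ℓ := by linarith
  have hXexp : X = Real.exp ℓ := by rw [hℓ, Real.exp_log hXpos]
  have hexp1 : (27 / 10 : ℝ) ≤ Real.exp 1 := by have := Real.exp_one_gt_d9; linarith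
  have hexp3 : (19 : ℝ) ≤ Real.exp 3 := by
    have : Real.exp 3 = Real.exp 1 ^ 3 := by rw [← Real.exp_nat_mul]; norm_num
    rw [this]
    calc (19 : ℝ) ≤ (27 / 10) ^ 3 := by norm_num
      _ ≤ Real.exp 1 ^ 3 := pow_le_pow_left₀ (by norm_num) hexp1 3
  have hexp4 : (53 : ℝ) ≤ Real.exp 4 := by
    have : Real.exp 4 = Real.exp 1 ^ 4 := by rw [← Real.exp_nat_mul]; norm_num
    rw [this]
    calc (53 : ℝ) ≤ (27 / 10) ^ 4 := by norm_num
      _ ≤ Real.exp 1 ^ 4 := pow_le_pow_left₀ (by norm_num) hexp1 4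
  have hX28 : 53 ≤ X := by
    have h4 : (4 : ℝ) ≤ ℓ₁ := by have := Real.add_one_le_exp (27 : ℝ); linarith
    have := Real.exp_le_exp.2 h4
    linarith
  have hX3 : 3 ≤ X := by linarith
  have hℓ53 : 53 ≤ ℓ := by
    have := Real.exp_le_exp.2 (show (4 : ℝ) ≤ 27 by norm_num)
    linarith
  have hY0 : 0 < Y := by linarith
  have hY3 : 3 ≤ Y := by linarith
  have hlogℓ27 : 27 ≤ Real.log ℓ := by
    rw [← Real.log_exp 27]; exact Real.log_le_log (Real.exp_pos _) (hℓ₁27.trans hℓge)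
  have hlogℓ1 : 1 ≤ Real.log ℓ := by linarith
  have hlogℓ0 : 0 < Real.log ℓ := by linarith
  set τq := ℓ ^ (-(1 / 4 : ℝ)) with hτq
  have hτq0 : 0 < τq := Real.rpow_pos_of_pos hℓ0 _
  have hτq_eq : ∀ C : ℝ, C / Real.log X ^ (1 / 4 : ℝ) = C * τq := fun C => by
    rw [hτq, Real.rpow_neg hℓ0.le, div_eq_mul_inv]
  have hτq1 : 1 / ℓ ≤ τq := by
    rw [hτq, one_div, ← Real.rpow_neg_one]; exact rpow_neg_le_rpow_neg hℓ1 (by norm_num)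
  /- the sums -/
  set g := toComplexAF f with hg
  have hgm : g.IsMultiplicative := isMultiplicative_toComplexAF hf
  have hg1 : ∀ n, ‖g n‖ ≤ 1 := norm_toComplexAF_le hf1
  have hg11 : g 1 = 1 := hgm.map_one
  set SX := ∑ n ∈ Icc 1 ⌊X⌋₊, f n with hSX
  set SY := ∑ n ∈ Icc 1 ⌊Y⌋₊, f n with hSY
  set sX := X⁻¹ * SX with hsX
  set sY := Y⁻¹ * SY with hsY
  have hnSX : ‖∑ n ∈ Icc 1 ⌊X⌋₊, g n‖ = |SX| := norm_sum_toComplexAF f _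
  have hnSY : ‖∑ n ∈ Icc 1 ⌊Y⌋₊, g n‖ = |SY| := norm_sum_toComplexAF f _
  have habsX : |sX| = |SX| / X := by rw [hsX, abs_mul, abs_inv, abs_of_pos hXpos]; ring
  have habsY : |sY| = |SY| / Y := by rw [hsY, abs_mul, abs_inv, abs_of_pos hY0]; ring
  have hS1 : ∀ {Z : ℝ}, 0 ≤ Z → |∑ n ∈ Icc 1 ⌊Z⌋₊, f n| ≤ Z := fun {Z} hZ => by
    calc |∑ n ∈ Icc 1 ⌊Z⌋₊, f n| ≤ ∑ n ∈ Icc 1 ⌊Z⌋₊, |f n| := Finset.abs_sum_le_sum_abs _ _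
      _ ≤ ∑ n ∈ Icc 1 ⌊Z⌋₊, (1 : ℝ) := Finset.sum_le_sum fun n _ => hf1 n
      _ = ⌊Z⌋₊ := by simp
      _ ≤ Z := Nat.floor_le hZ
  have hsX1 : |sX| ≤ 1 := by rw [habsX, div_le_one hXpos]; exact hS1 hXpos.le
  have hsY1 : |sY| ≤ 1 := by rw [habsY, div_le_one hY0]; exact hS1 hY0.le
  rw [hτq_eq]
  change |sX - sY| ≤ (2 * B₃ + 96 * |Cc| + 2) * τq
  /- the comparison parameter `w = X/Y ∈ [1, 4]` -/
  have hw1 : 1 ≤ X / Y := (one_le_div hY0).2 hYX'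
  have hw4 : X / Y ≤ 4 := by rw [div_le_iff₀ hY0]; linarith
  have hwX : X / Y ≤ Real.sqrt X := by
    have : (4 : ℝ) ≤ Real.sqrt X := by
      rw [show (4 : ℝ) = Real.sqrt (4 ^ 2) by rw [Real.sqrt_sq (by norm_num)]]
      exact Real.sqrt_le_sqrt (by linarith)
    linarith
  have hXw : X / (X / Y) = Y := by field_simp
  have hwX' : X / Y / X = Y⁻¹ := by field_simp
  /- bounds for the `w`-terms: `(log 2w/ℓ)^α log(ℓ/log 2w) ≤ 37 τq` -/
  have hα : 9 / 25 ≤ 1 - 2 / Real.pi := by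
    have hπ := Real.pi_gt_d2
    rw [le_sub_iff_add_le, show (9:ℝ)/25 + 2/Real.pi = 9/25 + 2/Real.pi from rfl]
    have : 2 / Real.pi ≤ 16 / 25 := by rw [div_le_div_iff₀ Real.pi_pos (by norm_num)]; linarith
    linarith
  have hα' : 1 - 2 / Real.pi ≤ 1 / 2 := by
    have hπ := Real.pi_lt_four
    have : 1 / 2 ≤ 2 / Real.pi := by rw [div_le_div_iff₀ (by norm_num) Real.pi_pos]; linarith
    linarith
  have hlog2w : Real.log 2 ≤ Real.log (2 * (X / Y)) ∧ Real.log (2 * (X / Y)) ≤ 3 := by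
    constructor
    · exact Real.log_le_log two_pos (by linarith)
    · calc Real.log (2 * (X / Y)) ≤ Real.log (Real.exp 3) := Real.log_le_log (by linarith) (by linarith)
        _ = 3 := Real.log_exp 3
  have hlog2 : 1 / 2 < Real.log 2 := by have := Real.log_two_gt_d9; linarith
  have hwterm : (Real.log (2 * (X / Y)) / Real.log X) ^ (1 - 2 / Real.pi)
      * Real.log (Real.log X / Real.log (2 * (X / Y))) ≤ 37 * τq := by
    rw [← hℓ]
    obtain ⟨hl, hu⟩ := hlog2w
    have hb0 : 0 < Real.log (2 * (X / Y)) / ℓ := div_pos (by linarith) hℓ0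
    have hb1 : Real.log (2 * (X / Y)) / ℓ ≤ 1 := by rw [div_le_one hℓ0]; linarith
    have h1 : (Real.log (2 * (X / Y)) / ℓ) ^ (1 - 2 / Real.pi) ≤ (3 / ℓ) ^ (9 / 25 : ℝ) :=
      (Real.rpow_le_rpow_of_exponent_ge hb0 hb1 hα).trans
        (Real.rpow_le_rpow hb0.le (div_le_div_of_nonneg_right hu hℓ0.le) (by norm_num))
    have h2 : Real.log (ℓ / Real.log (2 * (X / Y))) ≤ 2 * Real.log ℓ := by
      have : ℓ / Real.log (2 * (X / Y)) ≤ ℓ ^ 2 := by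
        rw [div_le_iff₀ (by linarith)]
        have h1 : 1 ≤ ℓ * Real.log (2 * (X / Y)) := by nlinarith only [hℓ27, hl, hlog2]
        calc ℓ = ℓ * 1 := (mul_one ℓ).symm
          _ ≤ ℓ * (ℓ * Real.log (2 * (X / Y))) := mul_le_mul_of_nonneg_left h1 hℓ0.le
          _ = ℓ ^ 2 * Real.log (2 * (X / Y)) := by ring
      calc Real.log (ℓ / Real.log (2 * (X / Y))) ≤ Real.log (ℓ ^ 2) :=
            Real.log_le_log (div_pos hℓ0 (by linarith)) this
        _ = 2 * Real.log ℓ := by rw [Real.log_pow]; norm_num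
    have h3 : (3 / ℓ) ^ (9 / 25 : ℝ) ≤ 2 * ℓ ^ (-(9 / 25 : ℝ)) := by
      rw [Real.div_rpow (by norm_num) hℓ0.le, Real.rpow_neg hℓ0.le, div_eq_mul_inv]
      refine mul_le_mul_of_nonneg_right ?_ (by positivity)
      have h39 : ((3 : ℝ) ^ (9 / 25 : ℝ)) ^ (25 : ℕ) ≤ (2 : ℝ) ^ (25 : ℕ) := by
        rw [← Real.rpow_natCast, ← Real.rpow_mul (by norm_num)]; norm_num
      exact le_of_pow_le_pow_left₀ (by norm_num) (by norm_num) h39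
    have h4 := log_mul_rpow_neg_le_quarter (a := 9 / 25) (ε := 11 / 100) hℓ1 (by norm_num) (by norm_num)
    have hlog0 : 0 ≤ Real.log (ℓ / Real.log (2 * (X / Y))) := Real.log_nonneg (by
      rw [le_div_iff₀ (by linarith)]; linarith)
    calc (Real.log (2 * (X / Y)) / ℓ) ^ (1 - 2 / Real.pi) * Real.log (ℓ / Real.log (2 * (X / Y)))
        ≤ (2 * ℓ ^ (-(9 / 25 : ℝ))) * (2 * Real.log ℓ) :=
          mul_le_mul (h1.trans h3) h2 hlog0 (by positivity)
      _ = 4 * (Real.log ℓ * ℓ ^ (-(9 / 25 : ℝ))) := by ring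
      _ ≤ 4 * ((11 / 100 : ℝ)⁻¹ * ℓ ^ (-(1 / 4 : ℝ))) := by gcongr
      _ = (4 * (11 / 100 : ℝ)⁻¹) * τq := by rw [hτq]; ring
      _ ≤ 37 * τq := mul_le_mul_of_nonneg_right (by norm_num) hτq0.le
  /- the `log log x` terms -/
  have hsqrt3 : 267 / 1000 ≤ 2 - Real.sqrt 3 := by
    have : Real.sqrt 3 ≤ 1733 / 1000 := by
      rw [show (1733 / 1000 : ℝ) = Real.sqrt ((1733 / 1000) ^ 2) by rw [Real.sqrt_sq (by norm_num)]]
      exact Real.sqrt_le_sqrt (by norm_num)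
    linarith
  have hcterm : Real.log (Real.log X) / Real.log X ^ (2 - Real.sqrt 3) ≤ 59 * τq := by
    rw [← hℓ]
    have h1 : Real.log ℓ / ℓ ^ (2 - Real.sqrt 3) ≤ Real.log ℓ * ℓ ^ (-(267 / 1000 : ℝ)) := by
      rw [div_eq_mul_inv, ← Real.rpow_neg hℓ0.le]
      exact mul_le_mul_of_nonneg_left (rpow_neg_le_rpow_neg hℓ1 hsqrt3) hlogℓ0.le
    have h2 := log_mul_rpow_neg_le_quarter (a := 267 / 1000) (ε := 17 / 1000) hℓ1 (by norm_num) (by norm_num)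
    refine h1.trans (h2.trans ?_)
    rw [← hτq]
    exact mul_le_mul_of_nonneg_right (by norm_num) hτq0.le
  have h3term : Real.log (Real.log X) ^ (1 + 2 * (1 - 2 / Real.pi)) / Real.log X ^ (1 - 2 / Real.pi) ≤ 331 * τq := by
    rw [← hℓ]
    have h1 : Real.log ℓ ^ (1 + 2 * (1 - 2 / Real.pi)) ≤ Real.log ℓ ^ 2 := by
      have := Real.rpow_le_rpow_of_exponent_le hlogℓ1 (by linarith : 1 + 2 * (1 - 2 / Real.pi) ≤ (2 : ℝ))
      rwa [Real.rpow_two] at this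
    have h2 : (Real.log ℓ ^ 2) / ℓ ^ (1 - 2 / Real.pi) ≤ Real.log ℓ ^ 2 * ℓ ^ (-(9 / 25 : ℝ)) := by
      rw [div_eq_mul_inv, ← Real.rpow_neg hℓ0.le]
      exact mul_le_mul_of_nonneg_left (rpow_neg_le_rpow_neg hℓ1 hα) (sq_nonneg _)
    have h3 := log_sq_mul_rpow_neg_le_quarter (a := 9 / 25) (ε := 55 / 1000) hℓ1 (by norm_num) (by norm_num)
    calc Real.log ℓ ^ (1 + 2 * (1 - 2 / Real.pi)) / ℓ ^ (1 - 2 / Real.pi)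
        ≤ Real.log ℓ ^ 2 / ℓ ^ (1 - 2 / Real.pi) := div_le_div_of_nonneg_right h1 (by positivity)
      _ ≤ Real.log ℓ ^ 2 * ℓ ^ (-(9 / 25 : ℝ)) := h2
      _ ≤ (55 / 1000 : ℝ)⁻¹ ^ 2 * ℓ ^ (-(1 / 4 : ℝ)) := h3
      _ ≤ 331 * τq := by
          rw [← hτq]
          exact mul_le_mul_of_nonneg_right (by norm_num) hτq0.le
  have hRterm : |C₁| * (1 / ℓ + Real.log ℓ / ℓ) ≤ 3 * |C₁| * τq := by
    have h1 : Real.log ℓ / ℓ ≤ (4 / 3 : ℝ) * τq := by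
      have := log_mul_rpow_neg_le_quarter (a := 1) (ε := 3 / 4) hℓ1 (by norm_num) (by norm_num)
      rw [Real.rpow_neg_one, ← div_eq_mul_inv] at this
      refine this.trans ?_; rw [hτq]; norm_num
    have : 1 / ℓ + Real.log ℓ / ℓ ≤ 3 * τq := by linarith
    calc |C₁| * (1 / ℓ + Real.log ℓ / ℓ) ≤ |C₁| * (3 * τq) := mul_le_mul_of_nonneg_left this (abs_nonneg _)
      _ = 3 * |C₁| * τq := by ring
  /- Step 1: Corollary 3 -/
  have hStep1 : |(|sX| - |sY|)| ≤ 96 * |Cc| * τq := by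
    have key := Hc g hgm hg1 X (X / Y) hxc hw1 hwX
    rw [hXw, hnSX, hnSY, hwX', ← habsX, show Y⁻¹ * |SY| = |sY| by rw [habsY]; ring] at key
    refine key.trans ?_
    have hpos : 0 ≤ (Real.log (2 * (X / Y)) / Real.log X) ^ (1 - 2 / Real.pi)
        * Real.log (Real.log X / Real.log (2 * (X / Y))) + Real.log (Real.log X) / Real.log X ^ (2 - Real.sqrt 3) := by
      rw [← hℓ]
      refine add_nonneg (mul_nonneg (Real.rpow_nonneg (div_nonneg (by linarith [hlog2w.1]) hℓ0.le) _)
        (Real.log_nonneg ?_)) (by positivity)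
      rw [le_div_iff₀ (by linarith [hlog2w.1])]; linarith [hlog2w.2]
    calc Cc * _ ≤ |Cc| * _ := mul_le_mul_of_nonneg_right (le_abs_self Cc) hpos
      _ ≤ |Cc| * (37 * τq + 59 * τq) := mul_le_mul_of_nonneg_left (add_le_add hwterm hcterm) (abs_nonneg _)
      _ = 96 * |Cc| * τq := by ring
  /- Step 2: equal signs -/
  by_cases hsign : 0 ≤ sX * sY
  · have : |sX - sY| = |(|sX| - |sY|)| := by
      rcases le_or_gt 0 sX with h1 | h1
      · rcases le_or_gt 0 sY with h2 | h2
        · rw [abs_of_nonneg h1, abs_of_nonneg h2]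
        · rcases h1.eq_or_lt with h3 | h3
          · rw [← h3]; simp
          · exact absurd hsign (not_le.2 (mul_neg_of_pos_of_neg h3 h2))
      · have h2 : sY ≤ 0 := by
          by_contra h2; push Not at h2
          exact absurd hsign (not_le.2 (mul_neg_of_neg_of_pos h1 h2))
        rw [abs_of_neg h1, abs_of_nonpos h2, show sX - sY = -((-sX) - (-sY)) by ring, abs_neg]
    rw [this]
    refine hStep1.trans ?_
    rw [show 96 * |Cc| * τq = (96 * |Cc|) * τq by ring]
    exact mul_le_mul_of_nonneg_right (by linarith [abs_nonneg Cc]) hτq0.le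
  push Not at hsign
  /- Step 3: opposite signs — it suffices to bound `|sX|` -/
  suffices hcase3 : |sX| ≤ B₃ * τq by
    have h1 : |sY| ≤ |sX| + 96 * |Cc| * τq := by
      have := abs_sub_abs_le_abs_sub sY sX
      rw [abs_sub_comm] at this
      linarith [le_abs_self (|sX| - |sY|), neg_abs_le (|sX| - |sY|), hStep1]
    calc |sX - sY| ≤ |sX| + |sY| := abs_sub _ _
      _ ≤ 2 * (B₃ * τq) + 96 * |Cc| * τq := by linarith
      _ = (2 * B₃ + 96 * |Cc|) * τq := by ring
      _ ≤ (2 * B₃ + 96 * |Cc| + 2) * τq := mul_le_mul_of_nonneg_right (by linarith) hτq0.le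
  /- the maximiser `y₀` and the size `Λ = |F(1+iy₀)|` -/
  obtain ⟨y₀, hy₀, hmax⟩ := exists_maximiser (g := g) hg1 X (T := ℓ) hℓ0.le
  have hy₀' : |y₀| ≤ 2 * Real.log X := by rw [← hℓ]; exact hy₀
  have hmax' : ∀ y : ℝ, |y| ≤ 2 * Real.log X →
      ‖truncEulerProduct g X (1 + y * I)‖ ≤ ‖truncEulerProduct g X (1 + y₀ * I)‖ := by
    rw [← hℓ]; exact hmax
  set Λ := ‖truncEulerProduct g X (1 + y₀ * I)‖ with hΛ
  obtain ⟨hM0, hMΛ⟩ := maxModulus_le (g := g) X hℓ0.le hmax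
  set L := maxModulus g X ℓ / ℓ with hL
  have hL0 : 0 ≤ L := div_nonneg hM0 hℓ0.le
  have hLΛ : L ≤ Λ / ℓ := div_le_div_of_nonneg_right hMΛ hℓ0.le
  -- Theorem 1 at `T = ℓ`
  have hT1 : |sX| ≤ L * (Real.log (Real.exp Real.eulerMascheroniConstant / L) + 12 / 7) + 3 * |C₁| * τq := by
    have key := H1 g hgm hg1 X ℓ hX3 hℓ1
    rw [← hℓ, hnSX, ← habsX] at key
    refine key.trans (add_le_add le_rfl ((mul_le_mul_of_nonneg_right (le_abs_self C₁) ?_).trans hRterm))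
    positivity
  -- two more rational exponent facts
  have hπlo : 4 / Real.pi ≤ 32 / 25 := by
    rw [div_le_div_iff₀ Real.pi_pos (by norm_num)]; have := Real.pi_gt_d2; linarith
  have hlogpow : Real.log ℓ ≤ 10 * ℓ ^ (1 / 10 : ℝ) := by
    have := Real.log_le_rpow_div hℓ0.le (by norm_num : (0:ℝ) < 1 / 10)
    linarith [show ℓ ^ (1 / 10 : ℝ) / (1 / 10) = 10 * ℓ ^ (1 / 10 : ℝ) by ring]
  have hpowA : A ≤ ℓ ^ (13 / 50 : ℝ) := by
    have h1 : (A ^ 4) ^ (13 / 50 : ℝ) ≤ ℓ ^ (13 / 50 : ℝ) :=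
      Real.rpow_le_rpow (by positivity) (hℓ₁A.trans hℓge) (by norm_num)
    have h2 : A ≤ (A ^ 4) ^ (13 / 50 : ℝ) := by
      rw [← Real.rpow_natCast, ← Real.rpow_mul (by linarith)]
      have := Real.rpow_le_rpow_of_exponent_le hA1 (show (1 : ℝ) ≤ (4 : ℕ) * (13 / 50) by norm_num)
      rwa [Real.rpow_one] at this
    exact h2.trans h1
  rcases le_or_gt (ℓ / 2) |y₀| with h3a | h3bc
  · /- 3a: `|y₀| ≥ ℓ/2`, Theorem 3 -/
    have key := H3 g hgm hg1 X hX3 y₀ hy₀' hmax'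
    rw [hnSX, ← habsX] at key
    have h1 : 1 / (1 + |y₀|) ≤ 2 * τq := by
      calc 1 / (1 + |y₀|) ≤ 1 / (ℓ / 2) := one_div_le_one_div_of_le (by linarith) (by linarith)
        _ = 2 * (1 / ℓ) := by field_simp
        _ ≤ 2 * τq := by linarith
    have hpos : 0 ≤ 1 / (1 + |y₀|) + Real.log (Real.log X) ^ (1 + 2 * (1 - 2 / Real.pi)) / Real.log X ^ (1 - 2 / Real.pi) := by
      rw [← hℓ]; positivity
    calc |sX| ≤ |C₃| * (1 / (1 + |y₀|) + Real.log (Real.log X) ^ (1 + 2 * (1 - 2 / Real.pi)) / Real.log X ^ (1 - 2 / Real.pi)) :=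
          key.trans (mul_le_mul_of_nonneg_right (le_abs_self _) hpos)
      _ ≤ |C₃| * (2 * τq + 331 * τq) := mul_le_mul_of_nonneg_left (add_le_add h1 h3term) (abs_nonneg _)
      _ = (333 * |C₃|) * τq := by ring
      _ ≤ B₃ * τq := mul_le_mul_of_nonneg_right (by rw [hB₃]; linarith [abs_nonneg C₁, abs_nonneg C₇, abs_nonneg C₄, (Real.exp_pos 7).le]) hτq0.le
  rcases le_or_gt (1 / 100) |y₀| with h3b | h3c
  · /- 3b: `1/100 ≤ |y₀| < ℓ/2`, Lemma 2.3 and Theorem 1 -/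
    have hβlo : 1 / Real.log X ≤ |2 * y₀| := by
      rw [← hℓ, abs_mul, abs_two]
      have : 1 / ℓ ≤ 1 / 53 := one_div_le_one_div_of_le (by norm_num) hℓ53
      linarith
    have hβhi : |2 * y₀| ≤ Real.log X := by rw [← hℓ, abs_mul, abs_two]; linarith
    have key := H23 g hgm hg1 X hX3 (-y₀) (2 * y₀) hβlo hβhi
    have e1 : ((-y₀ : ℝ) : ℂ) + ((2 * y₀ : ℝ) : ℂ) = (y₀ : ℂ) := by push_cast; ring
    have e2 := norm_truncEulerProduct_neg f X y₀
    rw [← hg] at e2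
    rw [e1, norm_mul, e2, ← hℓ] at key
    -- `Λ² ≤ C₂₃' ℓ^{32/25} · 50 (log ℓ)²`
    have hmx1 : 1 ≤ max (1 / |2 * y₀|) (Real.log ℓ ^ 2) :=
      le_max_of_le_right (by nlinarith only [hlogℓ1])
    have hmx50 : max (1 / |2 * y₀|) (Real.log ℓ ^ 2) ≤ 50 * Real.log ℓ ^ 2 := by
      refine max_le ?_ (by nlinarith only [hlogℓ1])
      rw [abs_mul, abs_two]
      calc 1 / (2 * |y₀|) ≤ 1 / (2 * (1 / 100)) := one_div_le_one_div_of_le (by norm_num) (by linarith)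
        _ = 50 := by norm_num
        _ ≤ 50 * Real.log ℓ ^ 2 := by nlinarith only [hlogℓ1]
    have hfac2 : max (1 / |2 * y₀|) (Real.log ℓ ^ 2) ^ (2 * (1 - 2 / Real.pi)) ≤ 50 * Real.log ℓ ^ 2 := by
      have := Real.rpow_le_rpow_of_exponent_le hmx1 (by linarith : 2 * (1 - 2 / Real.pi) ≤ (1 : ℝ))
      rw [Real.rpow_one] at this
      exact this.trans hmx50
    have hfac1 : ℓ ^ (4 / Real.pi) ≤ ℓ ^ (32 / 25 : ℝ) := Real.rpow_le_rpow_of_exponent_le hℓ1 hπlo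
    have hΛsq : Λ * Λ ≤ C₂₃' * ℓ ^ (32 / 25 : ℝ) * (50 * Real.log ℓ ^ 2) := by
      refine key.trans ?_
      have hnn : 0 ≤ ℓ ^ (4 / Real.pi) * max (1 / |2 * y₀|) (Real.log ℓ ^ 2) ^ (2 * (1 - 2 / Real.pi)) := by positivity
      calc C₂₃ * ℓ ^ (4 / Real.pi) * max (1 / |2 * y₀|) (Real.log ℓ ^ 2) ^ (2 * (1 - 2 / Real.pi))
          = C₂₃ * (ℓ ^ (4 / Real.pi) * max (1 / |2 * y₀|) (Real.log ℓ ^ 2) ^ (2 * (1 - 2 / Real.pi))) := by ring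
        _ ≤ C₂₃' * (ℓ ^ (32 / 25 : ℝ) * (50 * Real.log ℓ ^ 2)) :=
            mul_le_mul hC₂₃'le (mul_le_mul hfac1 hfac2 (by positivity) (by positivity)) hnn (by linarith)
        _ = _ := by ring
    -- `Λ ≤ √(50 C₂₃') ℓ^{16/25} log ℓ` and `L ≤ Lb := √(50C₂₃') ℓ^{-9/25} log ℓ`
    set R := Real.sqrt (50 * C₂₃') with hR
    have hR0 : 0 ≤ R := Real.sqrt_nonneg _
    have hRsq : R * R = 50 * C₂₃' := Real.mul_self_sqrt (by linarith)
    have hAR : A = 10 * R := by rw [hA, hR]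
    have hΛle : Λ ≤ R * ℓ ^ (16 / 25 : ℝ) * Real.log ℓ := by
      have hsq : Λ * Λ ≤ (R * ℓ ^ (16 / 25 : ℝ) * Real.log ℓ) * (R * ℓ ^ (16 / 25 : ℝ) * Real.log ℓ) := by
        have e : (R * ℓ ^ (16 / 25 : ℝ) * Real.log ℓ) * (R * ℓ ^ (16 / 25 : ℝ) * Real.log ℓ)
            = (R * R) * (ℓ ^ (16 / 25 : ℝ) * ℓ ^ (16 / 25 : ℝ)) * Real.log ℓ ^ 2 := by ring
        rw [e, hRsq, ← Real.rpow_add hℓ0]; norm_num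
        linarith [hΛsq]
      exact (mul_self_le_mul_self_iff (norm_nonneg _) (by positivity)).2 hsq
    set Lb := A * ℓ ^ (-(13 / 50 : ℝ)) with hLbdef
    have hLb : L ≤ Lb := by
      refine hLΛ.trans ?_
      rw [div_le_iff₀ hℓ0]
      have e3 : R * ℓ ^ (16 / 25 : ℝ) * (10 * ℓ ^ (1 / 10 : ℝ)) = A * ℓ ^ (37 / 50 : ℝ) := by
        rw [hAR, show (37 / 50 : ℝ) = 16 / 25 + 1 / 10 by norm_num, Real.rpow_add hℓ0]; ring
      have e4 : Lb * ℓ = A * ℓ ^ (37 / 50 : ℝ) := by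
        rw [hLbdef, show (37 / 50 : ℝ) = -(13 / 50) + 1 by norm_num, Real.rpow_add hℓ0, Real.rpow_one]; ring
      calc Λ ≤ R * ℓ ^ (16 / 25 : ℝ) * Real.log ℓ := hΛle
        _ ≤ R * ℓ ^ (16 / 25 : ℝ) * (10 * ℓ ^ (1 / 10 : ℝ)) := mul_le_mul_of_nonneg_left hlogpow (by positivity)
        _ = A * ℓ ^ (37 / 50 : ℝ) := e3
        _ = Lb * ℓ := e4.symm
    have hLb1 : Lb ≤ 1 := by
      rw [hLbdef, Real.rpow_neg hℓ0.le, ← div_eq_mul_inv, div_le_one (by positivity)]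
      exact hpowA
    have hmain := thm1_with_bound hT1 hL0 hLb hLb1
    have hLbpow : Lb ^ (39 / 40 : ℝ) ≤ A * τq := by
      rw [hLbdef, Real.mul_rpow (by linarith) (Real.rpow_nonneg hℓ0.le _), ← Real.rpow_mul hℓ0.le]
      refine mul_le_mul ?_ ?_ (by positivity) (by linarith)
      · have := Real.rpow_le_rpow_of_exponent_le hA1 (show (39 / 40 : ℝ) ≤ 1 by norm_num)
        rwa [Real.rpow_one] at this
      · rw [hτq]; norm_num; exact rpow_neg_le_rpow_neg hℓ1 (by norm_num)
    calc |sX| ≤ 43 * Lb ^ (39 / 40 : ℝ) + 3 * |C₁| * τq := hmain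
      _ ≤ 43 * (A * τq) + 3 * |C₁| * τq := by linarith [mul_le_mul_of_nonneg_left hLbpow (by norm_num : (0:ℝ) ≤ 43)]
      _ = (43 * A + 3 * |C₁|) * τq := by ring
      _ ≤ B₃ * τq := mul_le_mul_of_nonneg_right (by rw [hB₃]; linarith [abs_nonneg C₃, abs_nonneg C₁, abs_nonneg C₇, abs_nonneg C₄, (Real.exp_pos 7).le]) hτq0.le
  /- 3c: `|y₀| < 1/100` -/
  set M₀ := Msum g X y₀ with hM₀
  rcases le_or_gt (27 / 100 * Real.log ℓ) M₀ with hi | hii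
  · /- 3c-i: large pretentious sum: `Λ ≤ e⁷ ℓ e^{-M₀} ≤ e⁷ ℓ^{1 - 27/100}`, Theorem 1 -/
    have hΛ1 : Λ ≤ Real.exp 7 * ℓ * Real.exp (-M₀) := by
      have := norm_truncEulerProduct_le (g := g) hg1 hg11 (x := X) (by linarith) y₀
      rwa [← hℓ] at this
    have hexpM : Real.exp (-M₀) ≤ ℓ ^ (-(27 / 100 : ℝ)) := by
      rw [Real.rpow_def_of_pos hℓ0]
      exact Real.exp_le_exp.2 (by linarith)
    set Lb := Real.exp 7 * ℓ ^ (-(27 / 100 : ℝ)) with hLbdef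
    have hLb : L ≤ Lb := by
      refine hLΛ.trans ?_
      rw [div_le_iff₀ hℓ0]
      calc Λ ≤ Real.exp 7 * ℓ * Real.exp (-M₀) := hΛ1
        _ ≤ Real.exp 7 * ℓ * ℓ ^ (-(27 / 100 : ℝ)) := mul_le_mul_of_nonneg_left hexpM (by positivity)
        _ = Lb * ℓ := by rw [hLbdef]; ring
    have hLb1 : Lb ≤ 1 := by
      -- `e⁷ ≤ ℓ^{27/100}` since `ℓ ≥ e^{27}`
      have h1 : Real.exp 27 ^ (27 / 100 : ℝ) ≤ ℓ ^ (27 / 100 : ℝ) :=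
        Real.rpow_le_rpow (Real.exp_pos _).le (hℓ₁27.trans hℓge) (by norm_num)
      rw [← Real.exp_mul] at h1
      have h2 : Real.exp 7 ≤ Real.exp (27 * (27 / 100)) := Real.exp_le_exp.2 (by norm_num)
      rw [hLbdef, Real.rpow_neg hℓ0.le, ← div_eq_mul_inv, div_le_one (by positivity)]
      exact h2.trans h1
    have hmain := thm1_with_bound hT1 hL0 hLb hLb1
    have hLbpow : Lb ^ (39 / 40 : ℝ) ≤ Real.exp 7 * τq := by
      rw [hLbdef, Real.mul_rpow (Real.exp_pos _).le (Real.rpow_nonneg hℓ0.le _), ← Real.rpow_mul hℓ0.le]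
      refine mul_le_mul ?_ ?_ (by positivity) (Real.exp_pos _).le
      · have h1 : (1 : ℝ) ≤ Real.exp 7 := by have := Real.add_one_le_exp (7:ℝ); linarith
        have := Real.rpow_le_rpow_of_exponent_le h1 (show (39 / 40 : ℝ) ≤ 1 by norm_num)
        rwa [Real.rpow_one] at this
      · rw [hτq]; norm_num; exact rpow_neg_le_rpow_neg hℓ1 (by norm_num)
    calc |sX| ≤ 43 * Lb ^ (39 / 40 : ℝ) + 3 * |C₁| * τq := hmain
      _ ≤ 43 * (Real.exp 7 * τq) + 3 * |C₁| * τq := by linarith [mul_le_mul_of_nonneg_left hLbpow (by norm_num : (0:ℝ) ≤ 43)]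
      _ = (43 * Real.exp 7 + 3 * |C₁|) * τq := by ring
      _ ≤ B₃ * τq := mul_le_mul_of_nonneg_right (by rw [hB₃]; linarith [abs_nonneg C₃, abs_nonneg C₁, abs_nonneg C₇, abs_nonneg C₄, (Real.exp_pos 7).le, hA1]) hτq0.le
  /- 3c-ii: small pretentious sum: Lemma 7.1, Theorem 4 and the sign argument -/
  set g₀ := twistAF g y₀ with hg₀
  have hg₀m : g₀.IsMultiplicative := isMultiplicative_twistAF hgm y₀
  have hg₀1 : ∀ n, ‖g₀ n‖ ≤ 1 := norm_twistAF_le hg1 y₀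
  -- (7.4): the prime sum of `|1 - g₀(p)|/p`
  have hMert : ∑ p ∈ Nat.primesBelow (⌊X⌋₊ + 1), (1 : ℝ) / p ≤ Real.log ℓ + 4 := by
    have hN : 2 ≤ ⌊X⌋₊ := Nat.le_floor (by norm_num; linarith)
    refine (Literature.NumberTheory.LFunctions.MertensBound.sum_inv_prime_le ⌊X⌋₊ hN).trans ?_
    have hfl : (⌊X⌋₊ : ℝ) ≤ X := Nat.floor_le hXpos.le
    have hfl2 : (2 : ℝ) ≤ ⌊X⌋₊ := by exact_mod_cast hN
    have := Real.log_le_log (Real.log_pos (by linarith)) (Real.log_le_log (by linarith) hfl)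
    rw [← hℓ] at this; linarith
  have hSg : ∑ p ∈ Nat.primesBelow (⌊X⌋₊ + 1), ‖1 - g₀ p‖ / p ≤ 735 / 1000 * Real.log ℓ + 3 := by
    have hcs := sq_sum_norm_one_sub_le hg1 X y₀
    rw [← hM₀] at hcs
    set Sg1 := ∑ p ∈ Nat.primesBelow (⌊X⌋₊ + 1), ‖1 - g p * (p : ℂ) ^ (-(y₀ * I))‖ / p with hSg1
    have hSgeq : ∑ p ∈ Nat.primesBelow (⌊X⌋₊ + 1), ‖1 - g₀ p‖ / p = Sg1 := by
      rw [hSg1]; rfl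
    rw [hSgeq]
    have hSg0 : 0 ≤ Sg1 := Finset.sum_nonneg fun p _ => by positivity
    have hM₀0 : 0 ≤ M₀ := by
      rw [hM₀, Msum]
      refine Finset.sum_nonneg fun p hp => div_nonneg ?_ (Nat.cast_nonneg _)
      have h := norm_natCast_cpow_mul_I p (-y₀)
      rw [show ((-y₀ : ℝ) : ℂ) * I = -(y₀ * I) by push_cast; ring] at h
      have : (g p * (p : ℂ) ^ (-(y₀ * I))).re ≤ ‖g p * (p : ℂ) ^ (-(y₀ * I))‖ := Complex.re_le_norm _
      have : ‖g p * (p : ℂ) ^ (-(y₀ * I))‖ ≤ 1 := by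
        rw [norm_mul]; exact mul_le_one₀ (hg1 p) (norm_nonneg _) h
      linarith
    have hsq : Sg1 * Sg1 ≤ (735 / 1000 * (Real.log ℓ + 4)) * (735 / 1000 * (Real.log ℓ + 4)) := by
      calc Sg1 * Sg1 = Sg1 ^ 2 := (sq Sg1).symm
        _ ≤ 2 * (∑ p ∈ Nat.primesBelow (⌊X⌋₊ + 1), (1 : ℝ) / p) * M₀ := hcs
        _ ≤ 2 * (Real.log ℓ + 4) * (27 / 100 * Real.log ℓ) :=
            mul_le_mul (mul_le_mul_of_nonneg_left hMert zero_le_two) hii.le hM₀0 (by positivity)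
        _ ≤ (735 / 1000 * (Real.log ℓ + 4)) * (735 / 1000 * (Real.log ℓ + 4)) := by
            nlinarith only [hlogℓ1]
    have := (mul_self_le_mul_self_iff hSg0 (by positivity)).2 hsq
    linarith
  -- the common error bound from Lemma 7.1 at `Z ∈ {X, Y}`
  set u : ℂ := 1 + (y₀ : ℂ) * I with hu
  have hu1 : 1 ≤ ‖u‖ := one_le_norm_one_add_mul_I y₀
  have hu2 : ‖u‖ ≤ 101 / 100 := (norm_one_add_mul_I_le y₀).trans (by linarith [h3c.le])
  have hu0 : u ≠ 0 := by intro h; rw [h, norm_zero] at hu1; exact absurd hu1 (by norm_num)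
  have he3 : Real.exp 3 ≤ 201 / 10 := by
    have h1 : Real.exp 3 = Real.exp 1 ^ 3 := by rw [← Real.exp_nat_mul]; norm_num
    have h2 : Real.exp 1 ≤ 2.7182818286 := Real.exp_one_lt_d9.le
    rw [h1]
    calc Real.exp 1 ^ 3 ≤ (2.7182818286 : ℝ) ^ 3 := pow_le_pow_left₀ (Real.exp_pos 1).le h2 3
      _ ≤ 201 / 10 := by norm_num
  have hlogey : Real.log (Real.exp 1 + |y₀|) ≤ 101 / 100 := by
    have h1 : Real.log (Real.exp 1 + |y₀|) = 1 + Real.log (1 + |y₀| / Real.exp 1) := by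
      rw [show Real.exp 1 + |y₀| = Real.exp 1 * (1 + |y₀| / Real.exp 1) by field_simp,
        Real.log_mul (Real.exp_pos 1).ne' (by positivity), Real.log_exp]
    have h2 := Real.log_le_sub_one_of_pos (show 0 < 1 + |y₀| / Real.exp 1 by positivity)
    have h3 : |y₀| / Real.exp 1 ≤ |y₀| := div_le_self (abs_nonneg _) (by linarith [hexp1])
    linarith [h3c.le]
  have hE : ∀ {Z : ℝ}, 3 ≤ Z → Z ≤ X → X / 4 ≤ Z →
      ‖((Z⁻¹ * ∑ n ∈ Icc 1 ⌊Z⌋₊, f n : ℝ) : ℂ)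
          - (Z : ℂ) ^ ((y₀ : ℂ) * I) * u⁻¹ * ((Z : ℂ)⁻¹ * ∑ n ∈ Icc 1 ⌊Z⌋₊, g₀ n)‖ ≤ 41 * |C₇| * τq := by
    intro Z hZ3 hZX hZ4
    have hZ0 : 0 < Z := by linarith
    have key := H7 g₀ hg₀m hg₀1 Z hZ3 y₀
    rw [hg₀, sum_twistAF_mul_cpow g y₀, ← hg₀, hg, sum_toComplexAF f] at key
    -- the error term of Lemma 7.1
    have hexpSg : Real.exp (∑ p ∈ Nat.primesBelow (⌊Z⌋₊ + 1), ‖1 - g₀ p‖ / p) ≤ Real.exp 3 * ℓ ^ (735 / 1000 : ℝ) := by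
      have h1 : ∑ p ∈ Nat.primesBelow (⌊Z⌋₊ + 1), ‖1 - g₀ p‖ / p ≤ ∑ p ∈ Nat.primesBelow (⌊X⌋₊ + 1), ‖1 - g₀ p‖ / p :=
        Finset.sum_le_sum_of_subset_of_nonneg (primesBelow_mono hZX) fun p _ _ => by positivity
      calc Real.exp (∑ p ∈ Nat.primesBelow (⌊Z⌋₊ + 1), ‖1 - g₀ p‖ / p)
          ≤ Real.exp (735 / 1000 * Real.log ℓ + 3) := Real.exp_le_exp.2 (h1.trans hSg)
        _ = Real.exp 3 * ℓ ^ (735 / 1000 : ℝ) := by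
            rw [Real.exp_add, Real.rpow_def_of_pos hℓ0]; ring_nf
    have hlogZ : ℓ / 2 ≤ Real.log Z := by
      have h1 : Real.log (X / 4) ≤ Real.log Z := Real.log_le_log (by positivity) hZ4
      rw [Real.log_div hXpos.ne' (by norm_num), ← hℓ] at h1
      have h2 : Real.log 4 ≤ ℓ / 2 := by
        have : Real.log 4 ≤ Real.log (Real.exp 3) := Real.log_le_log (by norm_num) (by linarith)
        rw [Real.log_exp] at this; linarith
      linarith
    have hlogZ0 : 0 < Real.log Z := by linarith
    have hbound : C₇ * (Z / Real.log Z) * Real.log (Real.exp 1 + |y₀|)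
        * Real.exp (∑ p ∈ Nat.primesBelow (⌊Z⌋₊ + 1), ‖1 - g₀ p‖ / p) ≤ Z * (41 * |C₇| * τq) := by
      have hZl : Z / Real.log Z ≤ 2 * Z / ℓ := by
        rw [div_le_div_iff₀ hlogZ0 hℓ0]; nlinarith only [hlogZ, hZ0]
      have hpow : ℓ ^ (735 / 1000 : ℝ) / ℓ = ℓ ^ (-(265 / 1000 : ℝ)) := by
        rw [div_eq_iff hℓ0.ne', ← Real.rpow_add_one hℓ0.ne']; norm_num
      have hτ : ℓ ^ (-(265 / 1000 : ℝ)) ≤ τq := by rw [hτq]; exact rpow_neg_le_rpow_neg hℓ1 (by norm_num)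
      calc C₇ * (Z / Real.log Z) * Real.log (Real.exp 1 + |y₀|) * Real.exp (∑ p ∈ Nat.primesBelow (⌊Z⌋₊ + 1), ‖1 - g₀ p‖ / p)
          ≤ |C₇| * (2 * Z / ℓ) * (101 / 100) * (Real.exp 3 * ℓ ^ (735 / 1000 : ℝ)) := by
            have a1 : C₇ * (Z / Real.log Z) * Real.log (Real.exp 1 + |y₀|)
                ≤ |C₇| * (2 * Z / ℓ) * (101 / 100) :=
              calc C₇ * (Z / Real.log Z) * Real.log (Real.exp 1 + |y₀|)
                  ≤ |C₇ * (Z / Real.log Z) * Real.log (Real.exp 1 + |y₀|)| := le_abs_self _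
                _ = |C₇| * (Z / Real.log Z) * Real.log (Real.exp 1 + |y₀|) := by
                    rw [abs_mul, abs_mul, abs_of_pos (div_pos hZ0 hlogZ0),
                      abs_of_nonneg (Real.log_nonneg (by linarith [hexp1, abs_nonneg y₀]))]
                _ ≤ |C₇| * (2 * Z / ℓ) * (101 / 100) :=
                    mul_le_mul (mul_le_mul_of_nonneg_left hZl (abs_nonneg _)) hlogey
                      (Real.log_nonneg (by linarith [hexp1, abs_nonneg y₀])) (by positivity)
            exact mul_le_mul a1 hexpSg (Real.exp_pos _).le (by positivity)
        _ = Z * ((202 / 100 * Real.exp 3) * |C₇| * (ℓ ^ (735 / 1000 : ℝ) / ℓ)) := by ring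
        _ ≤ Z * (41 * |C₇| * τq) := by
            refine mul_le_mul_of_nonneg_left ?_ hZ0.le
            rw [hpow]
            refine mul_le_mul (mul_le_mul_of_nonneg_right (by linarith) (abs_nonneg _)) hτ
              (Real.rpow_nonneg hℓ0.le _) (by positivity)
    -- divide by `Z`
    have hsc : ((Z⁻¹ * ∑ n ∈ Icc 1 ⌊Z⌋₊, f n : ℝ) : ℂ)
        - (Z : ℂ) ^ ((y₀ : ℂ) * I) * u⁻¹ * ((Z : ℂ)⁻¹ * ∑ n ∈ Icc 1 ⌊Z⌋₊, g₀ n)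
        = (Z : ℂ)⁻¹ * (((∑ n ∈ Icc 1 ⌊Z⌋₊, f n : ℝ) : ℂ)
            - (Z : ℂ) ^ ((y₀ : ℂ) * I) / (1 + (y₀ : ℂ) * I) * ∑ n ∈ Icc 1 ⌊Z⌋₊, g₀ n) := by
      rw [hu]; push_cast; field_simp
    rw [hsc, norm_mul, norm_inv, Complex.norm_real, Real.norm_eq_abs, abs_of_pos hZ0,
      inv_mul_le_iff₀ hZ0]
    exact key.trans hbound
  -- Theorem 4: the twisted averages at `X` and `Y` are close
  have hbXY : ‖(X : ℂ)⁻¹ * ∑ n ∈ Icc 1 ⌊X⌋₊, g₀ n - (Y : ℂ)⁻¹ * ∑ n ∈ Icc 1 ⌊Y⌋₊, g₀ n‖ ≤ 368 * |C₄| * τq := by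
    have key := H4 g hgm hg1 X hx₄ y₀ hy₀' hmax' (X / Y) hw1 hwX
    rw [hXw, hwX'] at key
    have e1 : ∀ N : ℕ, ∑ n ∈ Icc 1 N, g n * (n : ℂ) ^ (-((y₀ : ℂ) * I)) = ∑ n ∈ Icc 1 N, g₀ n := fun N => rfl
    rw [e1, e1, show (((Y⁻¹ : ℝ)) : ℂ) = (Y : ℂ)⁻¹ by push_cast; rfl] at key
    refine key.trans ?_
    have hpos : 0 ≤ (Real.log (2 * (X / Y)) / Real.log X) ^ (1 - 2 / Real.pi)
        * Real.log (Real.log X / Real.log (2 * (X / Y)))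
        + Real.log (Real.log X) ^ (1 + 2 * (1 - 2 / Real.pi)) / Real.log X ^ (1 - 2 / Real.pi) := by
      rw [← hℓ]
      refine add_nonneg (mul_nonneg (Real.rpow_nonneg (div_nonneg (by linarith [hlog2w.1]) hℓ0.le) _)
        (Real.log_nonneg ?_)) (by positivity)
      rw [le_div_iff₀ (by linarith [hlog2w.1])]; linarith [hlog2w.2]
    calc C₄ * _ ≤ |C₄| * _ := mul_le_mul_of_nonneg_right (le_abs_self C₄) hpos
      _ ≤ |C₄| * (37 * τq + 331 * τq) := mul_le_mul_of_nonneg_left (add_le_add hwterm h3term) (abs_nonneg _)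
      _ = 368 * |C₄| * τq := by ring
  -- the sign argument
  have hPXY : ‖(X : ℂ) ^ ((y₀ : ℂ) * I) - (Y : ℂ) ^ ((y₀ : ℂ) * I)‖ ≤ 142 / 10000 := by
    refine (norm_cpow_sub_cpow_le hY0 hYX' y₀).trans ?_
    have h4 : Real.log (X / Y) ≤ 142 / 100 := by
      calc Real.log (X / Y) ≤ Real.log 4 := Real.log_le_log (by positivity) hw4
        _ = 2 * Real.log 2 := by rw [show (4:ℝ) = 2 ^ 2 by norm_num, Real.log_pow]; norm_num
        _ ≤ 142 / 100 := by have := Real.log_two_lt_d9; linarith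
    calc |y₀| * Real.log (X / Y) ≤ (1 / 100) * (142 / 100) :=
          mul_le_mul h3c.le h4 (Real.log_nonneg hw1) (by norm_num)
      _ = 142 / 10000 := by norm_num
  have hEX := hE hX3 le_rfl (by linarith)
  have hEY := hE hY3 hYX' hYX
  have hfin := sign_trick (sX := sX) (sY := sY) hu2 hu1 (norm_ofReal_cpow_mul_I hXpos y₀) (norm_ofReal_cpow_mul_I hY0 y₀)
    hPXY (by positivity) hEX hEY hbXY hsign
  calc |sX| ≤ 3 * (41 * |C₇| * τq) + 368 * |C₄| * τq := hfin
    _ = (123 * |C₇| + 368 * |C₄|) * τq := by ring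
    _ ≤ B₃ * τq := mul_le_mul_of_nonneg_right (by rw [hB₃]; linarith [abs_nonneg C₃, abs_nonneg C₁, abs_nonneg C₇, abs_nonneg C₄, (Real.exp_pos 7).le, hA1]) hτq0.le


end MatomakiRadziwillL4A

/-- **Deprecated — vacuous** (verdict clean-up 2026-08-15): the hypothesis `h4`,
`GranvilleSoundararajan2003_theorem4_sqrtRange`, is refuted in tree
(`GranvilleSoundararajan2003_theorem4_sqrtRange_false`) and `@[deprecated]`; use
`MatomakiRadziwill2016_lemma4_of_GS_central` (`MatomakiRadziwillLemma4LipschitzCentral.lean`) or the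
unconditional `MatomakiRadziwill2016_lemma4_holds` (`MatomakiRadziwillTheorem3VK.lean`).
Formerly: **Lemma 4 of Matomäki–Radziwiłł from the Granville–Soundararajan facts** (paper-facing name):
composition of `MatomakiRadziwillL4A.lipschitz_of_GS` with `MatomakiRadziwill2016_lemma4_of_lipschitz`.
[cite: MatomakiRadziwillAnnals2016, §3, Lemma 4] -/
@[deprecated "vacuous: the hypothesis GranvilleSoundararajan2003_theorem4_sqrtRange is refuted \
  (GranvilleSoundararajan2003_theorem4_sqrtRange_false); use \
  Literature.NumberTheory.Sieve.MatomakiRadziwill2016_lemma4_of_GS_central \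
  (MatomakiRadziwillLemma4LipschitzCentral.lean) or MatomakiRadziwill2016_lemma4_holds \
  (MatomakiRadziwillTheorem3VK.lean)" (since := "2026-08-15")]
theorem MatomakiRadziwill2016_lemma4_of_GS (h1 : Literature.NumberTheory.LFunctions.GranvilleSoundararajan.GranvilleSoundararajan2003_theorem1)
    (h23 : Literature.NumberTheory.LFunctions.GranvilleSoundararajan.GranvilleSoundararajan2003_lemma23)
    (h3 : Literature.NumberTheory.LFunctions.GranvilleSoundararajan.GranvilleSoundararajan2003_theorem3)
    (h4 : Literature.NumberTheory.LFunctions.GranvilleSoundararajan.GranvilleSoundararajan2003_theorem4_sqrtRange)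
    (hc3 : Literature.NumberTheory.LFunctions.GranvilleSoundararajan.GranvilleSoundararajan2003_corollary3)
    (h71 : Literature.NumberTheory.LFunctions.GranvilleSoundararajan.GranvilleSoundararajan2003_lemma71) :
    MatomakiRadziwill2016_lemma4 :=
  MatomakiRadziwill2016_lemma4_of_lipschitz (MatomakiRadziwillL4A.lipschitz_of_GS h1 h23 h3 h4 hc3 h71)

end Literature.NumberTheory.Sieve
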